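import Mathlib
import Literature.NumberTheory.Sieve.ShnirelmanGoldbachCells
import Literature.NumberTheory.Sieve.TwoResidueSelbergSumExplicit
import Literature.NumberTheory.Sieve.RomanoffExplicitAllN
import Literature.Combinatorics.Additive.MannTheorem
import Literature.NumberTheory.LFunctions.ChebyshevSylvesterPsi
import Literature.NumberTheory.LFunctions.ChebyshevPsiExplicit
import HarnessLib

/-!
# An explicit Shnirel'man–Goldbach theorem, continued (V): every integer `> 1` is a sum of at most `45` primes (`47` → `45`; `41` under RS (3.3))

Topic `Literature/NumberTheory/Sieve`; namespace `Literature.NumberTheory.Sieve.ShnirelmanGoldbachExplicit` (continued —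
these are §23–§24 of the story of `ShnirelmanGoldbachExplicit.lean` (§1–§12, `≤ 501`), `ShnirelmanGoldbachFlatten.lean`
(§13–§15, `≤ 77`), `ShnirelmanGoldbachBonferroni.lean` (§16–§19, `≤ 59`), `ShnirelmanGoldbachShifts.lean` (§20–§21,
`≤ 53`) and `ShnirelmanGoldbachCells.lean` (§22, `≤ 47`), kept in its own module because those files are at or near the
gate's size cap).  Cell `parity-ideate` seat p5 g19, ROUND-39 «THREE» and ROUND-40 «CELLS-2»
(`round40/SchnirelmannCells2.lean` sha16 af991b1e0448a5be, its §6 and §7, lines 4335–5248 and 6195–7012, with the needed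
§1/§2/§4.1/§5 helper copies; its §A.3 = the 68-cell polynomial `TlowK3` is §10 of `TwoResidueSelbergSumExplicit.lean`; its
§A.2/§2–§5 = §9 there and §19–§22 of the earlier modules), landed with statements and proofs verbatim (helpers `private`;
the `private` helpers of the earlier modules it calls are re-proved here as verbatim `private` copies, as in the source).
No named facts, no definitions, no instances, no notation.

## References
* [Nathanson1996] M. B. Nathanson, *Additive Number Theory: The Classical Bases*, GTM 164 (1996), §7.3 Lemma 7.6,
  Lemma 7.7, Theorem 7.8, Theorem 7.9 (Goldbach–Shnirel'man).
* [BatemanDiamond2004] P. T. Bateman, H. G. Diamond, *Analytic Number Theory: An Introductory Course* (2004), §13.4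
  (13.13)–(13.14), Lemma 13.11, Theorem 13.8: the explicit large-sieve/Selberg step behind `explicit_of_largeSieve_kappa2_c`,
  `explicit_of_largeSieve_kappa3_c`.
* [RosserSchoenfeld1962] J. B. Rosser, L. Schoenfeld, *Approximate formulas for some functions of prime numbers*,
  Illinois J. Math. 6 (1962), Theorem 2, eq. (3.3) (the conditional column's input).
* [Chebyshev1852] P. L. Chebyshev, *Mémoire sur les nombres premiers*, J. Math. Pures Appl. 17 (1852), §5 (the constant
  `A = 0.92129…`; via the tree module `ChebyshevPsiExplicit`).
* [Sylvester1892] J. J. Sylvester, *On arithmetical series*, Messenger of Math. 21 (1892), 1–19, 87–120.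

## Content

* §23 (ROUND-39 «THREE», the conditional column): a FIFTH glue regime with THREE shifted copies of the primes,
  `(p+q)/2` for `q ∈ {3, 5, 7}` (`three_shift_count`: pair weight `∑ f = 3` instead of `7`, two-term inclusion–exclusion),
  and the enlarged-cell sieve step re-instantiated from `e^40` (`explicit_of_largeSieve_kappa2_c40`,
  `pairCount_le_of_numeric2_c40`: `A₄ = 17.09`; `pairCount_le_1709`, `pairCount_le_1323` (`e^118`), `pairCount_le_1246`
  (`e^207`), `goldbachCount_le_1209` (`e^324`)); the five-regime glue under Rosser–Schoenfeld (3.3) holds with `h ≥ 20`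
  (`half_count_ge_allN_three_RS`); at `(Λs, Λ₀, A) = (324, 336, 12.09)`: `x/40` even Goldbach numbers under (3.3)
  (`goldbach_even_count_ge_of_RS_40`), `σ(B) ≥ 1/20` and **`schnirelmann_goldbach_of_RS_le_41`** (Mann: `2·20 + 1`).
* §24 (ROUND-40 «CELLS-2», the unconditional column): the sieve main term read through the 68-cell polynomial
  `TwoResidueSelbergExplicit.TlowK3` (`Qsum_ge_kappa3`, `X ≥ 2^22`): **`explicit_of_largeSieve_kappa3_c`** (`Λ ≥ 60`),
  `goldbachCount_le_of_numeric3_c`, the count constant `A = 11.70` from `e^327` (`c = 16`, `goldbachCount_le_1170`); the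
  pointwise Chebyshev bound **`primeCounting_ge_div20`** (`(x+2)/20 ≤ π(x)` for `122 ≤ x`, `log x ≤ 14`, from the tree's
  `ChebyshevExplicit.psi_ge_chebyshev`); the UNCONDITIONAL five-regime glue with `h ≥ 22` (`half_count_ge_allN_three`);
  at `(Λs, Λ₀, A) = (327, 339, 11.70)`: `x/44` even Goldbach numbers (`goldbach_even_count_ge_44_exp339`, `c₁ = 0.441`),
  `σ(B) ≥ 1/22` (`schnirelmannDensity_half_ge_22`) and **`schnirelmann_goldbach_le_45`** (Mann: `2·22 + 1`): every `N ≥ 2`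
  is a sum of at most `45` primes, unconditionally.

Table of the series (K unconditional / under Rosser–Schoenfeld (3.3)): §9 4329/3121 → §10 1581/1141 → §11 791/571 →
§12 501/379 → §13 379/289 → §14 113/105 → §15 77/65 → §16 65/55 → §17 63/53 → §18 61/51 → §19 59/51 → §20 57/51 →
§21 53/47 → §22 47/43 → §23 47/41 → §24 45/41.
Print calibration (NOT formalised, not used): Klimov 1975 (`55`), Vaughan 1977 (`27`), Deshouillers 1977 (`26`),
Riesel–Vaughan 1983 (`19`), Ramaré 1995 (even `n`: `≤ 6` primes), Helfgott 2013 (`K ≤ 4`) — the constants here are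
those of the ELEMENTARY method with kernel-checked inputs, not a record in print.
-/

namespace Literature.NumberTheory.Sieve.ShnirelmanGoldbachExplicit

open Finset Real
open scoped Classical Pointwise
open Literature.NumberTheory.Sieve Literature.Combinatorics.Additive
open Literature.NumberTheory.Sieve.GoldbachSieveEight (ft Qsum sum_ft_le_Qsum)
open Literature.NumberTheory.Sieve.TwoResidueSelbergExplicit (kappaSet2 TlowK2 sum_ft_ge_kappa2 Qsum_ge_kappa2
  kappaSet3 TlowK3 sum_ft_ge_kappa3 Qsum_ge_kappa3)
open Literature.NumberTheory.Sieve.GoldbachLinnik (oddSingularFactor oddSingularFactor_nonneg)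
open Literature.NumberTheory.Sieve.RomanoffExplicit (PrimeCountingLowerMul primeCountingLowerMul_09212
  primeCounting_ge_div45)

/-! ### Private copies (verbatim) of the helpers of §1–§22 used below -/

/-- `#{p ≤ y : p prime} = π(y)`. [folklore] -/
private theorem card_filter_prime_range (y : ℕ) : #{p ∈ range (y + 1) | p.Prime} = Nat.primeCounting y := by
  rw [Nat.primeCounting, ← Nat.primesBelow_card_eq_primeCounting']
  rfl

/-- The halving map: `#{even N ∈ (0, 2y] : N = p + q} ≤ #{b ∈ (0, y] : b ∈ B}`, `B = {0, 1} ∪ {m : 2m = p + q}`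
(`N ↦ N/2`). [folklore] -/
private theorem even_goldbach_card_le_half (y : ℕ) :
    #{N ∈ Ioc 0 (2 * y) | Even N ∧ ∃ p q : ℕ, p.Prime ∧ q.Prime ∧ p + q = N}
      ≤ #{b ∈ Ioc 0 y | b ∈ (({0, 1} : Set ℕ) ∪ {m | ∃ p q : ℕ, p.Prime ∧ q.Prime ∧ p + q = 2 * m})} := by
  refine card_le_card_of_injOn (fun N => N / 2) ?_ ?_
  · intro N hN
    rw [mem_coe, mem_filter, mem_Ioc] at hN
    obtain ⟨⟨hN0, hNy⟩, ⟨k, hk⟩, p, q, hp, hq, hpq⟩ := hN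
    rw [mem_coe, mem_filter, mem_Ioc]
    dsimp only
    exact ⟨⟨by omega, by omega⟩, Or.inr ⟨p, q, hp, hq, by omega⟩⟩
  · intro N hN N' hN' h
    rw [mem_coe, mem_filter] at hN hN'
    obtain ⟨k, hk⟩ := hN.2.1
    obtain ⟨k', hk'⟩ := hN'.2.1
    simp only at h
    omega

/-- `σ(S) ≥ 1/K` from `S(N) ≥ N/K` (`N ≥ 1`), for any set `S`. [folklore] -/
private theorem schnirelmannDensity_ge_of_count' {S : Set ℕ} [DecidablePred (· ∈ S)] {K : ℕ}
    (h : ∀ N : ℕ, 1 ≤ N → (N : ℝ) / K ≤ #{a ∈ Ioc 0 N | a ∈ S}) :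
    (1 : ℝ) / K ≤ schnirelmannDensity S := by
  rw [le_schnirelmannDensity_iff]
  intro n hn
  have hn' : (0 : ℝ) < n := by exact_mod_cast hn
  rw [le_div_iff₀ hn']
  have := h n hn
  calc (1 : ℝ) / K * n = (n : ℝ) / K := by ring
    _ ≤ _ := by convert this using 2

/-- `f(n) ≥ 1`. [folklore] -/
private theorem one_le_oddSingularFactor' (n : ℕ) : 1 ≤ oddSingularFactor n := by
  unfold oddSingularFactor
  have h : ∏ _p ∈ n.primeFactors.filter (2 < ·), (1 : ℝ)
      ≤ ∏ p ∈ n.primeFactors.filter (2 < ·), (((p : ℝ) - 1) / ((p : ℝ) - 2)) := by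
    refine Finset.prod_le_prod (fun _ _ => zero_le_one) fun p hp => ?_
    rw [Finset.mem_filter] at hp
    have hp3 : (3 : ℝ) ≤ p := by exact_mod_cast hp.2
    rw [le_div_iff₀ (by linarith)]
    linarith
  simpa using h

/-- `2⁵⁹ ≤ e⁴¹`. [folklore] -/
private theorem two_pow_59_le_exp_41 : (2 : ℝ) ^ 59 ≤ Real.exp 41 := by
  have he : (2.718281828 : ℝ) ≤ Real.exp 1 := by have := Real.exp_one_gt_d9; linarith
  have h := pow_le_pow_left₀ (by norm_num) he 41
  rw [← Real.exp_nat_mul] at h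
  norm_num at h
  exact le_trans (by norm_num) h

/-- `((2y − 3 : ℕ) : ℝ) = 2y − 3` for `y ≥ 2`. [folklore] -/
private theorem cast_two_mul_sub_three {y : ℕ} (hy : 2 ≤ y) : ((2 * y - 3 : ℕ) : ℝ) = 2 * (y : ℝ) - 3 := by
  have h3y : 3 ≤ 2 * y := by omega
  rw [Nat.cast_sub h3y]
  push_cast
  ring

/-- `log n ≤ 14` for `n < 10⁶` (`10⁶ ≤ 2.7¹⁴ ≤ e¹⁴`). [folklore] -/
private theorem log_le_14_of_lt {n : ℕ} (hn0 : 0 < n) (h6 : n < 10 ^ 6) : Real.log (n : ℝ) ≤ 14 := by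
  have hn0' : (0 : ℝ) < n := by exact_mod_cast hn0
  have hy6 : (n : ℝ) ≤ (2.7 : ℝ) ^ 14 := by
    have : (n : ℝ) < 10 ^ 6 := by exact_mod_cast h6
    have h27 : (10 : ℝ) ^ 6 ≤ (2.7 : ℝ) ^ 14 := by norm_num
    linarith
  have he : (2.7 : ℝ) ≤ Real.exp 1 := by have := Real.exp_one_gt_d9; linarith
  have h14 : (2.7 : ℝ) ^ 14 ≤ Real.exp 14 := by
    rw [show (14 : ℝ) = ((14 : ℕ) : ℝ) * 1 by norm_num, Real.exp_nat_mul]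
    exact pow_le_pow_left₀ (by norm_num) he 14
  have := Real.log_le_log hn0' (hy6.trans h14)
  rwa [Real.log_exp] at this

/-- Membership in the odd-prime finset: odd primes `≤ 2y − q`. [folklore] -/
private theorem mem_oddPrimes_iff {q y p : ℕ} :
    p ∈ ((range (2 * y - q + 1)).filter Nat.Prime).erase 2 ↔ p.Prime ∧ p ≠ 2 ∧ p ≤ 2 * y - q := by
  rw [mem_erase, mem_filter, mem_range]
  constructor
  · rintro ⟨h2, hlt, hp⟩
    exact ⟨hp, h2, by omega⟩
  · rintro ⟨hp, h2, hle⟩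
    exact ⟨h2, by omega, hp⟩

/-- A prime `≠ 2` is odd. [folklore] -/
private theorem prime_ne_two_mod {p : ℕ} (hp : p.Prime) (h2 : p ≠ 2) : p % 2 = 1 := by
  rcases hp.eq_two_or_odd with h | h
  · exact absurd h h2
  · exact h

/-- `#S_q(y) + 1 = π(2y − q)` for odd `q` with `2 ≤ 2y − q` (`p ↦ (p+q)/2` is injective on odd `p`). [folklore] -/
private theorem card_shiftImg {q y : ℕ} (hq : q % 2 = 1) (h2 : 2 ≤ 2 * y - q) :
    #(shiftImg q y) + 1 = Nat.primeCounting (2 * y - q) := by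
  unfold shiftImg
  have hinj : Set.InjOn (fun p : ℕ => (p + q) / 2) ↑(((range (2 * y - q + 1)).filter Nat.Prime).erase 2) := by
    intro p hp p' hp' hpp'
    rw [mem_coe, mem_oddPrimes_iff] at hp hp'
    simp only at hpp'
    have h1 := prime_ne_two_mod hp.1 hp.2.1
    have h1' := prime_ne_two_mod hp'.1 hp'.2.1
    omega
  rw [card_image_of_injOn hinj]
  have hmem : 2 ∈ (range (2 * y - q + 1)).filter Nat.Prime := by
    rw [mem_filter, mem_range]
    exact ⟨by omega, Nat.prime_two⟩
  have hpos : 1 ≤ #((range (2 * y - q + 1)).filter Nat.Prime) := card_pos.mpr ⟨2, hmem⟩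
  rw [card_erase_of_mem hmem]
  rw [card_filter_prime_range] at hpos ⊢
  omega

/-- `S_q(y) ⊆ (0, y] ∩ B` for an odd prime `q` (`2·((p+q)/2) = p + q`). [folklore] -/
private theorem shiftImg_subset {q y : ℕ} (hq : q.Prime) (hq2 : q ≠ 2) :
    shiftImg q y ⊆ {b ∈ Ioc 0 y | b ∈ (({0, 1} : Set ℕ) ∪ {m | ∃ p q : ℕ, p.Prime ∧ q.Prime ∧ p + q = 2 * m})} := by
  intro m hm
  unfold shiftImg at hm
  rw [mem_image] at hm
  obtain ⟨p, hp, rfl⟩ := hm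
  rw [mem_oddPrimes_iff] at hp
  obtain ⟨hpp, hp2, hple⟩ := hp
  have h1 := prime_ne_two_mod hpp hp2
  have h2 := prime_ne_two_mod hq hq2
  have hp3 := hpp.two_le
  have hq3 := hq.two_le
  rw [mem_filter, mem_Ioc]
  exact ⟨⟨by omega, by omega⟩, Or.inr ⟨p, q, hpp, hq, by omega⟩⟩

/-- `#(S_q ∩ S_{q+d}) ≤ #{p ≤ 2y prime : p + d prime}` for odd `q` and even `d > 0`: a common element
`m = (p+q)/2 = (p'+q+d)/2` gives the prime pair `(p', p' + d) = (p', p)`. [folklore] -/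
private theorem card_shiftImg_inter_le {q q' d y : ℕ} (hq : q % 2 = 1) (hq' : q' % 2 = 1) (hd : q' = q + d) :
    #(shiftImg q y ∩ shiftImg q' y) ≤ #((Nat.primesLE (2 * y)).filter (fun p => (p + d).Prime)) := by
  calc #(shiftImg q y ∩ shiftImg q' y)
      ≤ #(((Nat.primesLE (2 * y)).filter (fun p => (p + d).Prime)).image (fun p : ℕ => (p + q') / 2)) := by
        refine card_le_card ?_
        intro m hm
        rw [mem_inter] at hm
        obtain ⟨hm1, hm2⟩ := hm
        unfold shiftImg at hm1 hm2
        rw [mem_image] at hm1 hm2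
        obtain ⟨p, hp, hpm⟩ := hm1
        obtain ⟨p', hp', rfl⟩ := hm2
        rw [mem_oddPrimes_iff] at hp hp'
        have h1 := prime_ne_two_mod hp.1 hp.2.1
        have h2 := prime_ne_two_mod hp'.1 hp'.2.1
        have hpp' : p = p' + d := by omega
        rw [mem_image]
        refine ⟨p', ?_, rfl⟩
        rw [mem_filter, Nat.mem_primesLE]
        refine ⟨⟨by omega, hp'.1⟩, ?_⟩
        rw [← hpp']
        exact hp.1
    _ ≤ _ := card_image_le

/-- `((2y − q : ℕ) : ℝ) = 2y − q` for `q ≤ 2y`. [folklore] -/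
private theorem cast_two_mul_sub {y q : ℕ} (h : q ≤ 2 * y) : ((2 * y - q : ℕ) : ℝ) = 2 * (y : ℝ) - q := by
  rw [Nat.cast_sub h]
  push_cast
  ring

/-- `f(2) = 1`. [folklore] -/
private theorem oddSingularFactor_two' : oddSingularFactor 2 = 1 := by
  rw [show (2 : ℕ) = 2 ^ 1 * 1 by norm_num, GoldbachLinnik.oddSingularFactor_two_pow_mul 1 one_ne_zero,
    GoldbachLinnik.oddSingularFactor_one]

/-- `f(4) = 1`. [folklore] -/
private theorem oddSingularFactor_four : oddSingularFactor 4 = 1 := by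
  rw [show (4 : ℕ) = 2 ^ 2 * 1 by norm_num, GoldbachLinnik.oddSingularFactor_two_pow_mul 2 one_ne_zero,
    GoldbachLinnik.oddSingularFactor_one]

/-- `f(8) = 1`. [folklore] -/
private theorem oddSingularFactor_eight : oddSingularFactor 8 = 1 := by
  rw [show (8 : ℕ) = 2 ^ 3 * 1 by norm_num, GoldbachLinnik.oddSingularFactor_two_pow_mul 3 one_ne_zero,
    GoldbachLinnik.oddSingularFactor_one]

/-- `f(6) = 2` (the factor `(3−1)/(3−2)`). [folklore] -/
private theorem oddSingularFactor_six : oddSingularFactor 6 = 2 := by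
  rw [show (6 : ℕ) = 2 ^ 1 * 3 by norm_num, GoldbachLinnik.oddSingularFactor_two_pow_mul 1 (by norm_num)]
  show ∏ p ∈ (Nat.primeFactors 3).filter (2 < ·), (((p : ℝ) - 1) / ((p : ℝ) - 2)) = 2
  rw [Nat.prime_three.primeFactors, Finset.filter_singleton, if_pos (by norm_num), Finset.prod_singleton]
  norm_num

/-- `f(10) = 4/3`. [folklore] -/
private theorem oddSingularFactor_ten : oddSingularFactor 10 = 4 / 3 := by
  rw [show (10 : ℕ) = 2 ^ 1 * 5 by norm_num, GoldbachLinnik.oddSingularFactor_two_pow_mul 1 (by norm_num)]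
  show ∏ p ∈ (Nat.primeFactors 5).filter (2 < ·), (((p : ℝ) - 1) / ((p : ℝ) - 2)) = 4 / 3
  rw [Nat.prime_five.primeFactors, Finset.filter_singleton, if_pos (by norm_num), Finset.prod_singleton]
  norm_num

/-- `f(12) = 2`. [folklore] -/
private theorem oddSingularFactor_twelve : oddSingularFactor 12 = 2 := by
  rw [show (12 : ℕ) = 2 ^ 2 * 3 by norm_num, GoldbachLinnik.oddSingularFactor_two_pow_mul 2 (by norm_num)]
  show ∏ p ∈ (Nat.primeFactors 3).filter (2 < ·), (((p : ℝ) - 1) / ((p : ℝ) - 2)) = 2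
  rw [Nat.prime_three.primeFactors, Finset.filter_singleton, if_pos (by norm_num), Finset.prod_singleton]
  norm_num

/-- `f(14) = 6/5`. [folklore] -/
private theorem oddSingularFactor_fourteen : oddSingularFactor 14 = 6 / 5 := by
  rw [show (14 : ℕ) = 2 ^ 1 * 7 by norm_num, GoldbachLinnik.oddSingularFactor_two_pow_mul 1 (by norm_num)]
  show ∏ p ∈ (Nat.primeFactors 7).filter (2 < ·), (((p : ℝ) - 1) / ((p : ℝ) - 2)) = 6 / 5
  rw [(by norm_num : Nat.Prime 7).primeFactors, Finset.filter_singleton, if_pos (by norm_num), Finset.prod_singleton]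
  norm_num

/-- `f(16) = 1`. [folklore] -/
private theorem oddSingularFactor_sixteen : oddSingularFactor 16 = 1 := by
  rw [show (16 : ℕ) = 2 ^ 4 * 1 by norm_num, GoldbachLinnik.oddSingularFactor_two_pow_mul 4 one_ne_zero,
    GoldbachLinnik.oddSingularFactor_one]

/-- `f(18) = 2`. [folklore] -/
private theorem oddSingularFactor_eighteen : oddSingularFactor 18 = 2 := by
  rw [show (18 : ℕ) = 2 ^ 1 * 9 by norm_num, GoldbachLinnik.oddSingularFactor_two_pow_mul 1 (by norm_num)]
  show ∏ p ∈ (Nat.primeFactors 9).filter (2 < ·), (((p : ℝ) - 1) / ((p : ℝ) - 2)) = 2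
  rw [show (9 : ℕ) = 3 ^ 2 by norm_num, Nat.primeFactors_prime_pow (by norm_num) Nat.prime_three,
    Finset.filter_singleton, if_pos (by norm_num), Finset.prod_singleton]
  norm_num

/-- `f(20) = 4 / 3`. [folklore] -/
private theorem oddSingularFactor_twenty : oddSingularFactor 20 = 4 / 3 := by
  rw [show (20 : ℕ) = 2 ^ 2 * 5 by norm_num, GoldbachLinnik.oddSingularFactor_two_pow_mul 2 (by norm_num)]
  show ∏ p ∈ (Nat.primeFactors 5).filter (2 < ·), (((p : ℝ) - 1) / ((p : ℝ) - 2)) = 4 / 3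
  rw [Nat.prime_five.primeFactors, Finset.filter_singleton, if_pos (by norm_num), Finset.prod_singleton]
  norm_num

/-- `f(22) = 10 / 9`. [folklore] -/
private theorem oddSingularFactor_twentytwo : oddSingularFactor 22 = 10 / 9 := by
  rw [show (22 : ℕ) = 2 ^ 1 * 11 by norm_num, GoldbachLinnik.oddSingularFactor_two_pow_mul 1 (by norm_num)]
  show ∏ p ∈ (Nat.primeFactors 11).filter (2 < ·), (((p : ℝ) - 1) / ((p : ℝ) - 2)) = 10 / 9
  rw [(by norm_num : Nat.Prime 11).primeFactors, Finset.filter_singleton, if_pos (by norm_num), Finset.prod_singleton]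
  norm_num

/-- `f(24) = 2`. [folklore] -/
private theorem oddSingularFactor_twentyfour : oddSingularFactor 24 = 2 := by
  rw [show (24 : ℕ) = 2 ^ 3 * 3 by norm_num, GoldbachLinnik.oddSingularFactor_two_pow_mul 3 (by norm_num)]
  show ∏ p ∈ (Nat.primeFactors 3).filter (2 < ·), (((p : ℝ) - 1) / ((p : ℝ) - 2)) = 2
  rw [Nat.prime_three.primeFactors, Finset.filter_singleton, if_pos (by norm_num), Finset.prod_singleton]
  norm_num

/-- `f(26) = 12 / 11`. [folklore] -/
private theorem oddSingularFactor_twentysix : oddSingularFactor 26 = 12 / 11 := by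
  rw [show (26 : ℕ) = 2 ^ 1 * 13 by norm_num, GoldbachLinnik.oddSingularFactor_two_pow_mul 1 (by norm_num)]
  show ∏ p ∈ (Nat.primeFactors 13).filter (2 < ·), (((p : ℝ) - 1) / ((p : ℝ) - 2)) = 12 / 11
  rw [(by norm_num : Nat.Prime 13).primeFactors, Finset.filter_singleton, if_pos (by norm_num), Finset.prod_singleton]
  norm_num

/-- `f(28) = 6 / 5`. [folklore] -/
private theorem oddSingularFactor_twentyeight : oddSingularFactor 28 = 6 / 5 := by
  rw [show (28 : ℕ) = 2 ^ 2 * 7 by norm_num, GoldbachLinnik.oddSingularFactor_two_pow_mul 2 (by norm_num)]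
  show ∏ p ∈ (Nat.primeFactors 7).filter (2 < ·), (((p : ℝ) - 1) / ((p : ℝ) - 2)) = 6 / 5
  rw [(by norm_num : Nat.Prime 7).primeFactors, Finset.filter_singleton, if_pos (by norm_num), Finset.prod_singleton]
  norm_num

/-- `f(30) = 8 / 3`. [folklore] -/
private theorem oddSingularFactor_thirty : oddSingularFactor 30 = 8 / 3 := by
  rw [show (30 : ℕ) = 2 ^ 1 * 15 by norm_num, GoldbachLinnik.oddSingularFactor_two_pow_mul 1 (by norm_num)]
  show ∏ p ∈ (Nat.primeFactors 15).filter (2 < ·), (((p : ℝ) - 1) / ((p : ℝ) - 2)) = 8 / 3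
  rw [show (15 : ℕ) = 3 * 5 by norm_num, Nat.primeFactors_mul (by norm_num) (by norm_num),
    Nat.prime_three.primeFactors, Nat.prime_five.primeFactors, Finset.filter_union, Finset.filter_singleton,
    Finset.filter_singleton, if_pos (by norm_num), if_pos (by norm_num), Finset.prod_union (by simp),
    Finset.prod_singleton, Finset.prod_singleton]
  norm_num

/-- `f(32) = 1`. [folklore] -/
private theorem oddSingularFactor_thirtytwo : oddSingularFactor 32 = 1 := by
  rw [show (32 : ℕ) = 2 ^ 5 * 1 by norm_num, GoldbachLinnik.oddSingularFactor_two_pow_mul 5 one_ne_zero,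
    GoldbachLinnik.oddSingularFactor_one]

/-- `f(34) = 16 / 15`. [folklore] -/
private theorem oddSingularFactor_thirtyfour : oddSingularFactor 34 = 16 / 15 := by
  rw [show (34 : ℕ) = 2 ^ 1 * 17 by norm_num, GoldbachLinnik.oddSingularFactor_two_pow_mul 1 (by norm_num)]
  show ∏ p ∈ (Nat.primeFactors 17).filter (2 < ·), (((p : ℝ) - 1) / ((p : ℝ) - 2)) = 16 / 15
  rw [(by norm_num : Nat.Prime 17).primeFactors, Finset.filter_singleton, if_pos (by norm_num), Finset.prod_singleton]
  norm_num

/-- `f(36) = 2`. [folklore] -/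
private theorem oddSingularFactor_thirtysix : oddSingularFactor 36 = 2 := by
  rw [show (36 : ℕ) = 2 ^ 2 * 9 by norm_num, GoldbachLinnik.oddSingularFactor_two_pow_mul 2 (by norm_num)]
  show ∏ p ∈ (Nat.primeFactors 9).filter (2 < ·), (((p : ℝ) - 1) / ((p : ℝ) - 2)) = 2
  rw [show (9 : ℕ) = 3 ^ 2 by norm_num, Nat.primeFactors_prime_pow (by norm_num) Nat.prime_three,
    Finset.filter_singleton, if_pos (by norm_num), Finset.prod_singleton]
  norm_num

/-- `f(38) = 18 / 17`. [folklore] -/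
private theorem oddSingularFactor_thirtyeight : oddSingularFactor 38 = 18 / 17 := by
  rw [show (38 : ℕ) = 2 ^ 1 * 19 by norm_num, GoldbachLinnik.oddSingularFactor_two_pow_mul 1 (by norm_num)]
  show ∏ p ∈ (Nat.primeFactors 19).filter (2 < ·), (((p : ℝ) - 1) / ((p : ℝ) - 2)) = 18 / 17
  rw [(by norm_num : Nat.Prime 19).primeFactors, Finset.filter_singleton, if_pos (by norm_num), Finset.prod_singleton]
  norm_num

/-- The boundary numerics from `L ≥ 41`: `(E/4 + 1)·L² ≤ 0.01·E²` once `100 L² ≤ E` (copy of the tree's private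
lemma). [folklore] -/
private theorem tail_numeric'' {L E : ℝ} (hL : 41 ≤ L) (hEL : 100 * L ^ 2 ≤ E) :
    (E / 4 + 1) * L ^ 2 ≤ 0.01 * E ^ 2 := by
  have hL2 : (1681 : ℝ) ≤ L ^ 2 := by nlinarith [hL]
  have hE : (168100 : ℝ) ≤ E := by linarith
  nlinarith [hEL, hE, hL2]

/-- `e^{2.0796} ≥ 8.00096 = 8·1.00012` (`2.0796 = 3·0.6931471808 + 0.0001584576`). [folklore] -/
private theorem exp_20796_ge : (8.00096 : ℝ) ≤ Real.exp 2.0796 := by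
  have hl2 : (2 : ℝ) ≤ Real.exp 0.6931471808 := by
    have h1 := Real.exp_log (show (0:ℝ) < 2 by norm_num)
    have h2 := Real.exp_le_exp.mpr Real.log_two_lt_d9.le
    linarith
  have hsmall : (1.0001584576 : ℝ) ≤ Real.exp 0.0001584576 := by
    have := Real.add_one_le_exp (0.0001584576 : ℝ); linarith
  have hprod : Real.exp (2.0796 : ℝ) = Real.exp 0.6931471808 ^ 3 * Real.exp 0.0001584576 := by
    rw [← Real.exp_nat_mul, ← Real.exp_add]; norm_num
  rw [hprod]
  have h8 : (8 : ℝ) ≤ Real.exp 0.6931471808 ^ 3 := by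
    have := pow_le_pow_left₀ (by norm_num : (0:ℝ) ≤ 2) hl2 3
    linarith [show ((2 : ℝ)) ^ 3 = 8 by norm_num]
  nlinarith [mul_le_mul h8 hsmall (by norm_num) (by positivity)]

/-- `e^{2.7728} ≥ 16.00192 = 16·1.00012` (`2.7728 = 4·0.6931471808 + 0.0002112768`). [folklore] -/
private theorem exp_27728_ge : (16.00192 : ℝ) ≤ Real.exp 2.7728 := by
  have hl2 : (2 : ℝ) ≤ Real.exp 0.6931471808 := by
    have h1 := Real.exp_log (show (0:ℝ) < 2 by norm_num)
    have h2 := Real.exp_le_exp.mpr Real.log_two_lt_d9.le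
    linarith
  have hsmall : (1.0002112768 : ℝ) ≤ Real.exp 0.0002112768 := by
    have := Real.add_one_le_exp (0.0002112768 : ℝ); linarith
  have hprod : Real.exp (2.7728 : ℝ) = Real.exp 0.6931471808 ^ 4 * Real.exp 0.0002112768 := by
    rw [← Real.exp_nat_mul, ← Real.exp_add]; norm_num
  rw [hprod]
  have h16 : (16 : ℝ) ≤ Real.exp 0.6931471808 ^ 4 := by
    have := pow_le_pow_left₀ (by norm_num : (0:ℝ) ≤ 2) hl2 4
    linarith [show ((2 : ℝ)) ^ 4 = 16 by norm_num]
  nlinarith [mul_le_mul h16 hsmall (by norm_num) (by positivity)]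

set_option maxHeartbeats 1600000 in

/-- `TlowK2` is increasing on `[2, ∞)`. [folklore] -/
private theorem TlowK2_mono {l₁ l : ℝ} (h₁ : 2 ≤ l₁) (h : l₁ ≤ l) : TlowK2 l₁ ≤ TlowK2 l := by
  unfold TlowK2; nlinarith [h₁, h, mul_nonneg (sub_nonneg.2 h) (sub_nonneg.2 h₁), sq_nonneg (l - l₁)]

/-- `e^{1.3865} ≥ 4.00048 = 4·1.00012` (`1.3865 = 2·0.6931471808 + 0.0002056384`). [folklore] -/
private theorem exp_13865_ge : (4.00048 : ℝ) ≤ Real.exp 1.3865 := by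
  have hl2 : (2 : ℝ) ≤ Real.exp 0.6931471808 := by
    have h1 := Real.exp_log (show (0:ℝ) < 2 by norm_num)
    have h2 := Real.exp_le_exp.mpr Real.log_two_lt_d9.le
    linarith
  have hsmall : (1.0002056384 : ℝ) ≤ Real.exp 0.0002056384 := by
    have := Real.add_one_le_exp (0.0002056384 : ℝ); linarith
  have hprod : Real.exp (1.3865 : ℝ) = Real.exp 0.6931471808 ^ 2 * Real.exp 0.0002056384 := by
    rw [← Real.exp_nat_mul, ← Real.exp_add]; norm_num
  rw [hprod]
  have h4 : (4 : ℝ) ≤ Real.exp 0.6931471808 ^ 2 := by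
    have := pow_le_pow_left₀ (by norm_num : (0:ℝ) ≤ 2) hl2 2
    linarith [show ((2 : ℝ)) ^ 2 = 4 by norm_num]
  nlinarith [mul_le_mul h4 hsmall (by norm_num) (by positivity)]

set_option maxHeartbeats 1600000 in

/-! ## §23 ROUND-39 «THREE»: a three-shift regime and the pair sieve from `e^40` (RS `h = 20`) -/

/-! ### §23.1 The sieve step from `e^40` -/

/-- `2⁵⁷ ≤ e⁴⁰`. [folklore] -/
private theorem two_pow_57_le_exp_40 : (2 : ℝ) ^ 57 ≤ Real.exp 40 := by
  have he : (2.718281828 : ℝ) ≤ Real.exp 1 := by have := Real.exp_one_gt_d9; linarith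
  have h := pow_le_pow_left₀ (by norm_num) he 40
  rw [← Real.exp_nat_mul] at h
  norm_num at h
  exact le_trans (by norm_num) h

/-- `2^57 ≤ e^40` as a numeral. [folklore] -/
private theorem numeral_le_exp_40 : (144115188075855872 : ℝ) ≤ Real.exp 40 := by
  have := two_pow_57_le_exp_40
  norm_num at this
  exact this

/-- The boundary numerics from `L ≥ 40`: `(E/4 + 1)·L² ≤ 0.01·E²` once `100 L² ≤ E`. [folklore] -/
private theorem tail_numeric40 {L E : ℝ} (hL : 40 ≤ L) (hEL : 100 * L ^ 2 ≤ E) :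
    (E / 4 + 1) * L ^ 2 ≤ 0.01 * E ^ 2 := by
  have hL2 : (1600 : ℝ) ≤ L ^ 2 := by nlinarith [hL]
  have hE : (160000 : ℝ) ≤ E := by linarith
  nlinarith [hEL, hE, hL2]

/-- `TlowK2(l₁) ≥ 99` for `l₁ ≥ 18.6`. [folklore] -/
private theorem TlowK2_ge' {l₁ : ℝ} (h₁ : 18.6 ≤ l₁) : 99 ≤ TlowK2 l₁ := by
  unfold TlowK2; nlinarith [h₁, sq_nonneg (l₁ - 18.6)]

set_option maxHeartbeats 1600000 in
/-- **The enlarged-cell explicit large-sieve step from `e^40`** (ROUND-39; as `explicit_of_largeSieve_kappa2_c` with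
`Λ ≥ max(40, 37.2 + 2·lc)` and `c ≤ 32`: `√N ≥ (L/2)^12/12! ≥ 8.5·10^6 ≥ 32·262145` at `L ≥ 40`, `TlowK2(l₁) ≥ 99` for
`l₁ ≥ 18.6`, and the boundary numerics from `L ≥ 40`).
[cite: BatemanDiamond2004, Thm 13.8, §13.4–13.5 pp. 325–328 (explicit form proved here)] -/
theorem explicit_of_largeSieve_kappa2_c40 {c : ℕ} {lc Λ A : ℝ} (hc4 : 4 ≤ c) (hc32 : c ≤ 32)
    (hlc : (c : ℝ) * 1.00012 ≤ Real.exp lc) (hΛ : 40 ≤ Λ) (hΛc : 37.2 + 2 * lc ≤ Λ)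
    (hA : ∀ L : ℝ, Λ ≤ L → ((c : ℝ) ^ 2 + 1) * L ^ 2
        ≤ (c : ℝ) ^ 2 * (A - 0.02) * TlowK2 (L / 2 - lc))
    {N : ℕ} {C F B : ℝ} (hN : Real.exp Λ ≤ (N : ℝ)) (hF1 : 1 ≤ F)
    (hB : B ≤ 2 * ((Nat.sqrt N / c : ℕ) : ℝ) + 2)
    (hBD : C * GoldbachSieveEight.Qsum ∅ (Nat.sqrt N / c) ≤ (((Nat.sqrt N / c : ℕ) : ℝ) ^ 2 + N - 1) * F
      + B * GoldbachSieveEight.Qsum ∅ (Nat.sqrt N / c)) :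
    C ≤ A * F * (N : ℝ) / Real.log (N : ℝ) ^ 2 := by
  have hN0 : (0 : ℝ) < N := lt_of_lt_of_le (Real.exp_pos Λ) hN
  set L := Real.log (N : ℝ) with hLdef
  have hL : Λ ≤ L := by
    have := Real.log_le_log (Real.exp_pos Λ) hN
    rwa [Real.log_exp] at this
  have hL40 : (40 : ℝ) ≤ L := le_trans hΛ hL
  have hL2pos : 0 < L ^ 2 := by positivity
  have hcpos : 0 < c := by omega
  have hc0 : (0 : ℝ) < c := by exact_mod_cast hcpos
  have hcR4 : (4 : ℝ) ≤ c := by exact_mod_cast hc4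
  have hcR32 : (c : ℝ) ≤ 32 := by exact_mod_cast hc32
  -- E = √N = exp(L/2)
  set E := Real.exp (L / 2) with hEdef
  have hE0 : 0 < E := Real.exp_pos _
  have hE2 : E ^ 2 = N := by
    have : E ^ 2 = Real.exp L := by rw [hEdef, sq, ← Real.exp_add]; ring_nf
    rw [this, hLdef, Real.exp_log hN0]
  have hE8 : (L / 2) ^ 8 / 40320 ≤ E := by
    have := Real.pow_div_factorial_le_exp (L / 2) (by linarith) 8
    simpa [Nat.factorial] using this
  have hLsq : (1600 : ℝ) ≤ L ^ 2 := by nlinarith [hL40]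
  have hL4 : (1600 : ℝ) ^ 2 ≤ (L ^ 2) ^ 2 := pow_le_pow_left₀ (by norm_num) hLsq 2
  have hEL : 100 * L ^ 2 ≤ E := by
    have h1 : (1600 : ℝ) ^ 2 * 1600 * L ^ 2 ≤ (L ^ 2) ^ 2 * L ^ 2 * L ^ 2 := by
      have := mul_le_mul hL4 hLsq (by norm_num) (by positivity)
      nlinarith [this, hL2pos]
    have h2 : (L / 2) ^ 8 / 40320 = (L ^ 2) ^ 2 * L ^ 2 * L ^ 2 / 10321920 := by ring
    rw [h2] at hE8
    nlinarith [h1, hE8]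
  have hE12 : (L / 2) ^ 12 / 479001600 ≤ E := by
    have := Real.pow_div_factorial_le_exp (L / 2) (by linarith) 12
    simpa [Nat.factorial] using this
  have hEbig2 : (8500000 : ℝ) ≤ E := by
    have h1 : ((20 : ℝ)) ^ 12 ≤ (L / 2) ^ 12 := pow_le_pow_left₀ (by norm_num) (by linarith) 12
    have h2 : ((20 : ℝ)) ^ 12 / 479001600 ≤ E := le_trans (div_le_div_of_nonneg_right h1 (by norm_num)) hE12
    norm_num at h2
    linarith
  -- s = ⌊√N⌋, X = s / c
  set s := Nat.sqrt N with hsdef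
  set X := s / c with hXdef
  have hs2 : (s : ℝ) ^ 2 ≤ N := by exact_mod_cast Nat.sqrt_le' N
  have hs2' : (N : ℝ) < ((s : ℝ) + 1) ^ 2 := by exact_mod_cast Nat.lt_succ_sqrt' N
  have hsE : (s : ℝ) ≤ E := by
    have : (s : ℝ) ^ 2 ≤ E ^ 2 := by rw [hE2]; exact hs2
    exact (pow_le_pow_iff_left₀ (Nat.cast_nonneg s) hE0.le two_ne_zero).mp this
  have hEs : E < (s : ℝ) + 1 := by
    have : E ^ 2 < ((s : ℝ) + 1) ^ 2 := by rw [hE2]; exact hs2'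
    exact (pow_lt_pow_iff_left₀ hE0.le (by positivity) two_ne_zero).mp this
  have hXc : X * c ≤ s := Nat.div_mul_le_self s c
  have hXc' : s + 1 ≤ X * c + c := Nat.lt_div_mul_add hcpos
  have hXcR : (X : ℝ) * c ≤ s := by exact_mod_cast hXc
  have hXcR' : (s : ℝ) + 1 ≤ (X : ℝ) * c + c := by exact_mod_cast hXc'
  have hX0R : (0 : ℝ) ≤ X := Nat.cast_nonneg X
  have hXR : (X : ℝ) ^ 2 * (c : ℝ) ^ 2 ≤ (N : ℝ) := by
    have : ((X : ℝ) * c) ^ 2 ≤ (s : ℝ) ^ 2 := pow_le_pow_left₀ (by positivity) hXcR 2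
    nlinarith [hs2, this]
  have hXlo : E / c - 1 < (X : ℝ) := by
    have h1 : E < (X : ℝ) * c + c := by linarith [hEs, hXcR']
    rw [sub_lt_iff_lt_add, div_lt_iff₀ hc0]; linarith
  have hXhi : (X : ℝ) ≤ E / c := by
    rw [le_div_iff₀ hc0]; linarith [hsE, hXcR]
  have hEc : (262145 : ℝ) ≤ E / c := by
    rw [le_div_iff₀ hc0]; nlinarith [hEbig2, hcR32]
  have hX0 : (0 : ℝ) < X := by linarith
  have hX262144 : 262144 ≤ X := by
    have : (262144 : ℝ) ≤ X := by linarith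
    exact_mod_cast this
  -- log X ≥ l₁ := L/2 − lc
  set l₁ := L / 2 - lc with hl₁def
  have hexp : Real.exp l₁ ≤ (X : ℝ) := by
    rw [hl₁def, Real.exp_sub]
    have hlc0 : (0 : ℝ) < (c : ℝ) * 1.00012 := by positivity
    have h1 : E / Real.exp lc ≤ E / ((c : ℝ) * 1.00012) :=
      div_le_div_of_nonneg_left hE0.le hlc0 hlc
    have h2 : E / ((c : ℝ) * 1.00012) ≤ E / c - 1 := by
      rw [show E / ((c : ℝ) * 1.00012) = E / c / 1.00012 by rw [div_div],
        div_le_iff₀ (by norm_num : (0 : ℝ) < 1.00012)]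
      linarith [hEc]
    linarith [hXlo]
  have hl : l₁ ≤ Real.log X := by
    rw [Real.le_log_iff_exp_le hX0]; exact hexp
  have hl₁ : (18.6 : ℝ) ≤ l₁ := by rw [hl₁def]; linarith
  -- Q ≥ TlowK2(log X) ≥ TlowK2(l₁) ≥ 99
  set Q := GoldbachSieveEight.Qsum ∅ X with hQdef
  have hQ : TlowK2 (Real.log X) ≤ Q := Qsum_ge_kappa2 hX262144
  have hQT : TlowK2 l₁ ≤ Q := le_trans (TlowK2_mono (by linarith) hl) hQ
  have hT₁ : (99 : ℝ) ≤ TlowK2 l₁ := TlowK2_ge' hl₁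
  have hQpos : 0 < Q := by linarith
  have hF0 : 0 ≤ F := le_trans zero_le_one hF1
  have hC1 : C ≤ ((X : ℝ) ^ 2 + N - 1) * F / Q + B := by
    have : C * Q ≤ (((X : ℝ) ^ 2 + N - 1) * F / Q + B) * Q := by
      rw [add_mul, div_mul_cancel₀ _ hQpos.ne']
      exact hBD
    exact le_of_mul_le_mul_right this hQpos
  have hc2pos : (0 : ℝ) < (c : ℝ) ^ 2 := by positivity
  set K : ℝ := ((c : ℝ) ^ 2 + 1) / (c : ℝ) ^ 2 with hKdef
  have hK0 : 0 < K := by positivity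
  have hC2 : ((X : ℝ) ^ 2 + N - 1) * F / Q ≤ K * (N : ℝ) * F / TlowK2 l₁ := by
    have hnum0 : 0 ≤ K * (N : ℝ) * F := by positivity
    have hXN : (X : ℝ) ^ 2 ≤ (N : ℝ) / (c : ℝ) ^ 2 := by rw [le_div_iff₀ hc2pos]; exact hXR
    have hKN : (X : ℝ) ^ 2 + N - 1 ≤ K * N := by
      have : K * N = N / (c : ℝ) ^ 2 + N := by rw [hKdef]; field_simp; ring
      rw [this]; linarith
    have hnum : ((X : ℝ) ^ 2 + N - 1) * F ≤ K * (N : ℝ) * F := mul_le_mul_of_nonneg_right hKN hF0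
    calc ((X : ℝ) ^ 2 + N - 1) * F / Q ≤ K * (N : ℝ) * F / Q := div_le_div_of_nonneg_right hnum hQpos.le
      _ ≤ K * (N : ℝ) * F / TlowK2 l₁ :=
          div_le_div_of_nonneg_left hnum0 (by linarith) hQT
  -- main term
  have hmain : K * (N : ℝ) * F / TlowK2 l₁ ≤ (A - 0.02) * F * (N : ℝ) / L ^ 2 := by
    have hkey : ((c : ℝ) ^ 2 + 1) * L ^ 2 ≤ (c : ℝ) ^ 2 * (A - 0.02) * TlowK2 l₁ := hA L hL
    have hkey' : K * L ^ 2 ≤ (A - 0.02) * TlowK2 l₁ := by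
      rw [hKdef, div_mul_eq_mul_div, div_le_iff₀ hc2pos]
      linarith [hkey]
    rw [div_le_div_iff₀ (by linarith) hL2pos]
    have hNF : 0 ≤ (N : ℝ) * F := by positivity
    have h := mul_le_mul_of_nonneg_left hkey' hNF
    calc K * (N : ℝ) * F * L ^ 2 = (N : ℝ) * F * (K * L ^ 2) := by ring
      _ ≤ (N : ℝ) * F * ((A - 0.02) * TlowK2 l₁) := h
      _ = (A - 0.02) * F * (N : ℝ) * TlowK2 l₁ := by ring
  -- boundary term
  have htail : B ≤ 0.02 * F * (N : ℝ) / L ^ 2 := by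
    have h2 : (E / 4 + 1) * L ^ 2 ≤ 0.01 * (N : ℝ) := by
      rw [← hE2]; exact tail_numeric40 hL40 hEL
    have h3 : 0.02 * (N : ℝ) ≤ 0.02 * F * (N : ℝ) :=
      calc 0.02 * (N : ℝ) ≤ F * (0.02 * (N : ℝ)) := le_mul_of_one_le_left (by positivity) hF1
        _ = 0.02 * F * (N : ℝ) := by ring
    rw [le_div_iff₀ hL2pos]
    have h1 : B * L ^ 2 ≤ 2 * ((E / 4 + 1) * L ^ 2) := by
      have hEc4 : E / c ≤ E / 4 := div_le_div_of_nonneg_left hE0.le (by norm_num) hcR4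
      have : B ≤ 2 * (E / 4 + 1) := by linarith only [hB, hXhi, hEc4]
      nlinarith only [this, hL2pos]
    linarith only [h1, h2, h3]
  calc C ≤ ((X : ℝ) ^ 2 + N - 1) * F / Q + B := hC1
    _ ≤ K * (N : ℝ) * F / TlowK2 l₁ + B := by linarith only [hC2]
    _ ≤ (A - 0.02) * F * (N : ℝ) / L ^ 2 + 0.02 * F * (N : ℝ) / L ^ 2 := add_le_add hmain htail
    _ = A * F * (N : ℝ) / L ^ 2 := by ring

/-- **Explicit PRIME-PAIR sieve bound with length `⌊√N⌋/c`, from `e^40`**: under the numerics of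
`explicit_of_largeSieve_kappa2_c40`, `#{p ≤ N : p + h prime} ≤ A·f(h)·N/log²N` for even `h ≠ 0`, `N ≥ e^Λ`.
[cite: BatemanDiamond2004, Thm 13.8 (explicit form proved here)] -/
theorem pairCount_le_of_numeric2_c40 {c : ℕ} {lc Λ A : ℝ} (hc4 : 4 ≤ c) (hc32 : c ≤ 32)
    (hlc : (c : ℝ) * 1.00012 ≤ Real.exp lc) (hΛ : 40 ≤ Λ) (hΛc : 37.2 + 2 * lc ≤ Λ)
    (hA : ∀ L : ℝ, Λ ≤ L → ((c : ℝ) ^ 2 + 1) * L ^ 2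
        ≤ (c : ℝ) ^ 2 * (A - 0.02) * TlowK2 (L / 2 - lc))
    {N h : ℕ} (hN : Real.exp Λ ≤ (N : ℝ)) (hh : h ≠ 0) (heven : Even h) :
    ((((Nat.primesLE N).filter fun p => (p + h).Prime).card : ℕ) : ℝ)
      ≤ A * oddSingularFactor h * (N : ℝ) / Real.log (N : ℝ) ^ 2 := by
  have h40 : Real.exp 40 ≤ (N : ℝ) := (Real.exp_le_exp.mpr hΛ).trans hN
  have h20 : (2 : ℝ) ^ 20 ≤ (N : ℝ) := le_trans (by norm_num) (two_pow_57_le_exp_40.trans h40)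
  have hX1 : 1 ≤ Nat.sqrt N / c := by
    have h20' : 2 ^ 20 ≤ N := by exact_mod_cast h20
    have hs : 1024 ≤ Nat.sqrt N := by
      rw [Nat.le_sqrt]
      calc 1024 * 1024 = 2 ^ 20 := by norm_num
        _ ≤ N := h20'
    exact (Nat.le_div_iff_mul_le (by omega)).mpr (by omega)
  have hBD := GoldbachSieveEight.card_primePairs_mul_Qsum_le 1 h N (Nat.sqrt N / c) le_rfl
    (Nat.one_le_iff_ne_zero.mpr hh) (by simpa using heven) hX1
  have hprod : (∏ p ∈ ((1 * h).primeFactors.filter (2 < ·)), (((p : ℝ) - 1) / ((p : ℝ) - 2)))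
      = oddSingularFactor h := by rw [one_mul]; rfl
  rw [hprod] at hBD
  have hmain := explicit_of_largeSieve_kappa2_c40 hc4 hc32 hlc hΛ hΛc hA hN
    (one_le_oddSingularFactor' _) (by linarith) hBD
  have hcount : ((range (N + 1)).filter (fun p => p.Prime ∧ (1 * p + h).Prime)).card
      = ((Nat.primesLE N).filter fun p => (p + h).Prime).card := by
    congr 1
    ext p
    simp only [mem_filter, mem_range, Nat.mem_primesLE, one_mul, Nat.lt_succ_iff]
    tauto
  rw [hcount] at hmain
  exact hmain

/-! ### §23.2 Numerics: `A = 17.09` from `e^40` (`c = 4`), `13.23` from `e^118`, `12.46` from `e^207` (`c = 8`), count `12.09` from `e^324` (`c = 16`) -/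

/-- `c = 4` numerics at `Λ = 40`: `17L² ≤ 16·17.07·TlowK2(L/2 − 1.3865)` for `L ≥ 40`. [folklore] -/
private theorem cells4_numeric_40 {L : ℝ} (hL : 40 ≤ L) :
    (((4 : ℕ) : ℝ) ^ 2 + 1) * L ^ 2 ≤ ((4 : ℕ) : ℝ) ^ 2 * (17.09 - 0.02) * TlowK2 (L / 2 - 1.3865) := by
  unfold TlowK2
  push_cast
  nlinarith [hL, mul_self_nonneg (L - 40)]

/-- `c = 8` numerics at `Λ = 118`: `65L² ≤ 64·13.21·TlowK2(L/2 − 2.0796)` for `L ≥ 118`. [folklore] -/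
private theorem cells8_numeric_118 {L : ℝ} (hL : 118 ≤ L) :
    (((8 : ℕ) : ℝ) ^ 2 + 1) * L ^ 2 ≤ ((8 : ℕ) : ℝ) ^ 2 * (13.23 - 0.02) * TlowK2 (L / 2 - 2.0796) := by
  unfold TlowK2
  push_cast
  nlinarith [hL, mul_self_nonneg (L - 118)]

/-- `c = 8` numerics at `Λ = 207`: `65L² ≤ 64·12.44·TlowK2(L/2 − 2.0796)` for `L ≥ 207`. [folklore] -/
private theorem cells8_numeric_207 {L : ℝ} (hL : 207 ≤ L) :
    (((8 : ℕ) : ℝ) ^ 2 + 1) * L ^ 2 ≤ ((8 : ℕ) : ℝ) ^ 2 * (12.46 - 0.02) * TlowK2 (L / 2 - 2.0796) := by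
  unfold TlowK2
  push_cast
  nlinarith [hL, mul_self_nonneg (L - 207)]

/-- `c = 16` numerics at `Λ = 324`: `257L² ≤ 256·12.07·TlowK2(L/2 − 2.7728)` for `L ≥ 324`. [folklore] -/
private theorem cells16_numeric_324 {L : ℝ} (hL : 324 ≤ L) :
    (((16 : ℕ) : ℝ) ^ 2 + 1) * L ^ 2 ≤ ((16 : ℕ) : ℝ) ^ 2 * (12.09 - 0.02) * TlowK2 (L / 2 - 2.7728) := by
  unfold TlowK2
  push_cast
  nlinarith [hL, mul_self_nonneg (L - 324)]

/-- **PAIR SIEVE `17.09` above `e^40`** (`c = 4`, enlarged cells, the `e^40` sieve step).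
[cite: BatemanDiamond2004, Thm 13.8, §13.4–13.5 pp. 325–328 (explicit form proved here)] -/
theorem pairCount_le_1709 {N h : ℕ} (hN : Real.exp 40 ≤ (N : ℝ)) (hh : h ≠ 0) (heven : Even h) :
    ((((Nat.primesLE N).filter fun p => (p + h).Prime).card : ℕ) : ℝ)
      ≤ 17.09 * oddSingularFactor h * (N : ℝ) / Real.log (N : ℝ) ^ 2 :=
  pairCount_le_of_numeric2_c40 (c := 4) (lc := 1.3865) (by norm_num) (by norm_num)
    (by have := exp_13865_ge; push_cast; linarith) (by norm_num) (by norm_num)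
    (fun _ hL => cells4_numeric_40 hL) hN hh heven

/-- **PAIR SIEVE `13.23` above `e^118`** (`c = 8`, enlarged cells). [cite: BatemanDiamond2004, Thm 13.8, §13.4–13.5 pp. 325–328 (explicit form proved here)] -/
theorem pairCount_le_1323 {N h : ℕ} (hN : Real.exp 118 ≤ (N : ℝ)) (hh : h ≠ 0) (heven : Even h) :
    ((((Nat.primesLE N).filter fun p => (p + h).Prime).card : ℕ) : ℝ)
      ≤ 13.23 * oddSingularFactor h * (N : ℝ) / Real.log (N : ℝ) ^ 2 :=
  pairCount_le_of_numeric2_c (c := 8) (lc := 2.0796) (by norm_num) (by norm_num)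
    (by have := exp_20796_ge; push_cast; linarith) (by norm_num) (by norm_num)
    (fun _ hL => cells8_numeric_118 hL) hN hh heven

/-- **PAIR SIEVE `12.46` above `e^207`** (`c = 8`, enlarged cells). [cite: BatemanDiamond2004, Thm 13.8, §13.4–13.5 pp. 325–328 (explicit form proved here)] -/
theorem pairCount_le_1246 {N h : ℕ} (hN : Real.exp 207 ≤ (N : ℝ)) (hh : h ≠ 0) (heven : Even h) :
    ((((Nat.primesLE N).filter fun p => (p + h).Prime).card : ℕ) : ℝ)
      ≤ 12.46 * oddSingularFactor h * (N : ℝ) / Real.log (N : ℝ) ^ 2 :=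
  pairCount_le_of_numeric2_c (c := 8) (lc := 2.0796) (by norm_num) (by norm_num)
    (by have := exp_20796_ge; push_cast; linarith) (by norm_num) (by norm_num)
    (fun _ hL => cells8_numeric_207 hL) hN hh heven

/-- **GOLDBACH SIEVE `12.09` above `e^324`** (`c = 16`, enlarged cells): `r(N) ≤ 12.09·f(N)·N/log²N` for even `N ≥ e^324`.
[cite: BatemanDiamond2004, §13.4 (13.13)–(13.14)] -/
theorem goldbachCount_le_1209 {N : ℕ} (hN : Real.exp 324 ≤ (N : ℝ)) (heven : Even N) :
    (SingularSeries.goldbachCount N : ℝ) ≤ 12.09 * oddSingularFactor N * (N : ℝ) / Real.log (N : ℝ) ^ 2 :=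
  goldbachCount_le_of_numeric2_c (c := 16) (lc := 2.7728) (by norm_num) (by norm_num)
    (by have := exp_27728_ge; push_cast; linarith) (by norm_num) (by norm_num)
    (fun _ hL => cells16_numeric_324 hL) hN heven

/-! ### §23.3 Three shifts `{3, 5, 7}` with inclusion–exclusion -/

/-- Two-term Bonferroni lower bound for three finsets, subtraction-free:
`#A + #B + #C ≤ #(A ∪ B ∪ C) + #(A ∩ B) + #(A ∩ C) + #(B ∩ C)`. [folklore] -/
private theorem bonferroni3 (A B C : Finset ℕ) :
    #A + #B + #C ≤ #(A ∪ B ∪ C) + (#(A ∩ B) + #(A ∩ C) + #(B ∩ C)) := by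
  have h1 := card_union_add_card_inter A B
  have h2 := card_union_add_card_inter (A ∪ B) C
  have e2 : (A ∪ B) ∩ C = (A ∩ C) ∪ (B ∩ C) := by
    ext x
    simp only [mem_inter, mem_union]
    tauto
  have h2' : #((A ∪ B) ∩ C) ≤ #(A ∩ C) + #(B ∩ C) := by
    rw [e2]
    exact card_union_le _ _
  omega

/-- **Three shifts with inclusion–exclusion**: for `2y ≥ 13`,
`π(2y−3) + π(2y−5) + π(2y−7) ≤ B(y) + 2 + 2P₂ + P₄`, `P_d = #{p ≤ 2y prime : p + d prime}`, `B(y) = #((0,y] ∩ B)`: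
the sets `S₃, S₅, S₇ ⊆ (0,y] ∩ B` avoid `1, 2 ∈ B`, have `#S_q = π(2y−q) − 1`, and their pairwise intersections are
counted by prime pairs with differences `2, 4, 2` — total singular weight `Σ f(d) = 3` against `7` for four shifts, which
is what opens the window already at `log(2y) ≈ 21`. [cite: Nathanson1996, Theorem 7.8 (shifted embeddings of the primes
into the halved set; three shifts with two-term inclusion–exclusion, proved here)] -/
theorem three_shift_count {y : ℕ} (hy : 13 ≤ 2 * y) :
    Nat.primeCounting (2 * y - 3) + Nat.primeCounting (2 * y - 5) + Nat.primeCounting (2 * y - 7)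
      ≤ #{b ∈ Ioc 0 y | b ∈ (({0, 1} : Set ℕ) ∪ {m | ∃ p q : ℕ, p.Prime ∧ q.Prime ∧ p + q = 2 * m})} + 2
        + (2 * #((Nat.primesLE (2 * y)).filter (fun p => (p + 2).Prime))
          + #((Nat.primesLE (2 * y)).filter (fun p => (p + 4).Prime))) := by
  have h3 := card_shiftImg (q := 3) (y := y) (by norm_num) (by omega)
  have h5 := card_shiftImg (q := 5) (y := y) (by norm_num) (by omega)
  have h7 := card_shiftImg (q := 7) (y := y) (by norm_num) (by omega)
  have hbon := bonferroni3 (shiftImg 3 y) (shiftImg 5 y) (shiftImg 7 y)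
  have i35 := card_shiftImg_inter_le (q := 3) (q' := 5) (d := 2) (y := y) (by norm_num) (by norm_num) (by norm_num)
  have i37 := card_shiftImg_inter_le (q := 3) (q' := 7) (d := 4) (y := y) (by norm_num) (by norm_num) (by norm_num)
  have i57 := card_shiftImg_inter_le (q := 5) (q' := 7) (d := 2) (y := y) (by norm_num) (by norm_num) (by norm_num)
  set U := shiftImg 3 y ∪ shiftImg 5 y ∪ shiftImg 7 y with hU
  have hUsub : U ⊆ {b ∈ Ioc 0 y | b ∈ (({0, 1} : Set ℕ) ∪ {m | ∃ p q : ℕ, p.Prime ∧ q.Prime ∧ p + q = 2 * m})} :=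
    union_subset (union_subset (shiftImg_subset Nat.prime_three (by norm_num))
      (shiftImg_subset (by norm_num) (by norm_num))) (shiftImg_subset (by norm_num) (by norm_num))
  have hmemU : ∀ m ∈ U, 3 ≤ m := by
    intro m hm
    rw [hU, mem_union, mem_union] at hm
    rcases hm with (hm | hm) | hm
    all_goals
      unfold shiftImg at hm
      rw [mem_image] at hm
      obtain ⟨p, hp, rfl⟩ := hm
      rw [mem_oddPrimes_iff] at hp
      have h1 := hp.1.two_le
      have h2 := hp.2.1
      omega
  have h2U : 2 ∉ U := fun h => by have := hmemU 2 h; omega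
  have h1U : 1 ∉ insert 2 U := by
    rw [mem_insert]
    rintro (h | h)
    · omega
    · have := hmemU 1 h; omega
  have hsub : insert 1 (insert 2 U)
      ⊆ {b ∈ Ioc 0 y | b ∈ (({0, 1} : Set ℕ) ∪ {m | ∃ p q : ℕ, p.Prime ∧ q.Prime ∧ p + q = 2 * m})} := by
    intro b hb
    rw [mem_insert, mem_insert] at hb
    rcases hb with rfl | rfl | hb
    · rw [mem_filter, mem_Ioc]
      exact ⟨⟨by omega, by omega⟩, Or.inl (by simp)⟩
    · rw [mem_filter, mem_Ioc]
      exact ⟨⟨by omega, by omega⟩, Or.inr ⟨2, 2, Nat.prime_two, Nat.prime_two, by norm_num⟩⟩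
    · exact hUsub hb
  have hcard := card_le_card hsub
  rw [card_insert_of_notMem h1U, card_insert_of_notMem h2U] at hcard
  omega

/-! ### §23.4 The five-regime RS glue -/

set_option maxHeartbeats 4000000 in
/-- **GLUE FOR ALL `y ≥ 1` UNDER (3.3), FIVE REGIMES, `h ≥ 18`** (ROUND-39 «THREE»): one shift below `e^{L₁}`
(`L₁ ≤ 2h`), THREE shifts `{3,5,7}` on `(e^{L₁}, e^{Lt}]` (`three_shift_count`; pair weight `2·17.09·3 = 102.54` with the
`e^40` pair sieve `pairCount_le_1709`), FOUR shifts on `(e^{Lt}, e^{L₂}]` (weight `2·17.09·7 = 239.26`), SEVEN shifts on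
`(e^{L₂}, e^{L₃}]` with `pairCount_le_1323` from `e^118` (weight `26.46·421/15 = 185661/250 ≤ 742.7`), TWELVE shifts on
`(e^{L₃}, e^{Λ₀})` with `pairCount_le_1246` from `e^207` (weight `24.92·163061/1683 = 101587003/42075 ≤ 2415`), the count above
`e^{Λ₀}`; prime counts from (3.3) (`π(x) > x/log x`, `x ≥ 17`): `L² + h ≤ h·(6L − 102.54)` on `[L₁, Lt]`,
`L² + h ≤ h·(8L − 239.26)` on `[Lt, L₂]`, `L² + h ≤ h·(14L − 742.7)` on `[L₂, L₃]`, `L² + h ≤ h·(24L − 2415)` on `[L₃, Λ₀]`;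
requires only `L₁ ≥ 40` (the `e^40` sieve step and `2^57 ≤ e^40`).
[cite: RosserSchoenfeld1962, Theorem 2, eq. (3.3) (as input)] -/
theorem half_count_ge_allN_three_RS (hRS : Literature.NumberTheory.LFunctions.RosserSchoenfeld1962_theorem2)
    {L₁ Lt L₂ L₃ Λ₀ : ℝ} {h : ℕ} (h18 : 18 ≤ h) (h40 : 40 ≤ L₁) (hL₁h : L₁ ≤ 2 * h)
    (hL₂ : 118 ≤ L₂) (hL₃ : 207 ≤ L₃) (hΛ4 : Λ₀ ≤ 10000)
    (hquad3 : ∀ L : ℝ, L₁ ≤ L → L ≤ Lt → L ^ 2 + h ≤ h * (6 * L - 102.54))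
    (hquad : ∀ L : ℝ, Lt ≤ L → L ≤ L₂ → L ^ 2 + h ≤ h * (8 * L - 239.26))
    (hquad7 : ∀ L : ℝ, L₂ ≤ L → L ≤ L₃ → L ^ 2 + h ≤ h * (14 * L - 742.7))
    (hquad12 : ∀ L : ℝ, L₃ ≤ L → L ≤ Λ₀ → L ^ 2 + h ≤ h * (24 * L - 2415))
    (hlarge : ∀ x : ℕ, Real.exp Λ₀ ≤ (x : ℝ) →
      (x : ℝ) / (2 * h) ≤ #{N ∈ Ioc 0 x | Even N ∧ ∃ p q : ℕ, p.Prime ∧ q.Prime ∧ p + q = N})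
    {y : ℕ} (hy : 1 ≤ y) :
    (y : ℝ) / h ≤ #{b ∈ Ioc 0 y | b ∈ (({0, 1} : Set ℕ) ∪ {m | ∃ p q : ℕ, p.Prime ∧ q.Prime ∧ p + q = 2 * m})} := by
  set B : Set ℕ := ({0, 1} : Set ℕ) ∪ {m | ∃ p q : ℕ, p.Prime ∧ q.Prime ∧ p + q = 2 * m} with hB
  have hhr : (18 : ℝ) ≤ h := by exact_mod_cast h18
  have hh0 : (0 : ℝ) < h := by linarith
  have hL₁pos : (0 : ℝ) < L₁ := by linarith
  by_cases hbig : Real.exp Λ₀ ≤ ((2 * y : ℕ) : ℝ)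
  · have h1 := hlarge (2 * y) hbig
    have h2 := even_goldbach_card_le_half y
    have e : ((2 * y : ℕ) : ℝ) / (2 * h) = (y : ℝ) / h := by
      push_cast
      field_simp
    rw [e] at h1
    exact h1.trans (by exact_mod_cast h2)
  rw [not_le] at hbig
  by_cases hsmall : y ≤ h
  · have h1 : 1 ≤ #{b ∈ Ioc 0 y | b ∈ B} :=
      card_pos.mpr ⟨1, by
        rw [mem_filter, mem_Ioc]
        exact ⟨⟨by omega, hy⟩, Or.inl (by simp)⟩⟩
    have h1' : (1 : ℝ) ≤ #{b ∈ Ioc 0 y | b ∈ B} := by exact_mod_cast h1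
    have h2 : (y : ℝ) / h ≤ 1 := by
      rw [div_le_one hh0]
      exact_mod_cast hsmall
    linarith
  rw [not_le] at hsmall
  have hy29 : 19 ≤ y := by omega
  have hnr : ((2 * y - 3 : ℕ) : ℝ) = 2 * (y : ℝ) - 3 := cast_two_mul_sub_three (by omega)
  have hy29r : (19 : ℝ) ≤ y := by exact_mod_cast hy29
  have hy0 : (0 : ℝ) < y := by linarith
  have hn55 : 35 ≤ 2 * y - 3 := by omega
  have hn0 : (0 : ℝ) < ((2 * y - 3 : ℕ) : ℝ) := by rw [hnr]; linarith
  have hn1 : (1 : ℝ) < ((2 * y - 3 : ℕ) : ℝ) := by rw [hnr]; linarith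
  have hlogpos : 0 < Real.log ((2 * y - 3 : ℕ) : ℝ) := Real.log_pos hn1
  by_cases hmid : Real.log ((2 * y - 3 : ℕ) : ℝ) ≤ L₁
  · -- ONE SHIFT below `e^{L₁}` (§15, RS)
    have hemb := primeCounting_shift_le_half_count (y := y) (by omega)
    have hembr : (Nat.primeCounting (2 * y - 3) : ℝ) + 1 ≤ #{b ∈ Ioc 0 y | b ∈ B} := by exact_mod_cast hemb
    refine le_trans ?_ hembr
    by_cases h67 : 67 ≤ 2 * y - 3
    · have hπ : 1 * ((2 * y - 3 : ℕ) : ℝ) / Real.log ((2 * y - 3 : ℕ) : ℝ)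
          ≤ (Nat.primeCounting (2 * y - 3) : ℝ) := by
        have := primeCountingLowerMul_one_of_RS hRS
        unfold PrimeCountingLowerMul at this
        exact this (2 * y - 3) h67
      rw [one_mul] at hπ
      have h2 : ((2 * y - 3 : ℕ) : ℝ) / L₁ ≤ ((2 * y - 3 : ℕ) : ℝ) / Real.log ((2 * y - 3 : ℕ) : ℝ) :=
        div_le_div_of_nonneg_left hn0.le hlogpos hmid
      have h3 : (y : ℝ) / h ≤ 2 * y / L₁ := by
        rw [div_le_div_iff₀ hh0 hL₁pos]
        nlinarith [mul_le_mul_of_nonneg_left hL₁h hy0.le]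
      have h4 : 2 * (y : ℝ) / L₁ ≤ ((2 * y - 3 : ℕ) : ℝ) / L₁ + 1 := by
        rw [hnr]
        have e : (2 * (y : ℝ) - 3) / L₁ = 2 * y / L₁ - 3 / L₁ := by
          field_simp
        rw [e]
        have : 3 / L₁ ≤ 1 := by
          rw [div_le_one hL₁pos]
          linarith
        linarith
      linarith [h2, h3, h4, hπ]
    · rw [not_le] at h67
      have hn32 : 32 ≤ 2 * y - 3 := by omega
      have hπ := ShnirelmanGoldbachTheorem.primeCounting_ge hn32
      have hlog7 : Real.log ((2 * y - 3 : ℕ) : ℝ) ≤ 7 := by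
        have hy7 : ((2 * y - 3 : ℕ) : ℝ) ≤ (2 : ℝ) ^ 7 := by
          have : ((2 * y - 3 : ℕ) : ℝ) < 67 := by exact_mod_cast h67
          have h27 : (67 : ℝ) ≤ (2 : ℝ) ^ 7 := by norm_num
          linarith
        have he : (2 : ℝ) ≤ Real.exp 1 := by have := Real.add_one_le_exp (1 : ℝ); linarith
        have h7 : (2 : ℝ) ^ 7 ≤ Real.exp 7 := by
          rw [show (7 : ℝ) = ((7 : ℕ) : ℝ) * 1 by norm_num, Real.exp_nat_mul]
          exact pow_le_pow_left₀ (by norm_num) he 7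
        have := Real.log_le_log hn0 (hy7.trans h7)
        rwa [Real.log_exp] at this
      have h5 : ((2 * y - 3 : ℕ) : ℝ) / 28 ≤ ((2 * y - 3 : ℕ) : ℝ) / (4 * Real.log ((2 * y - 3 : ℕ) : ℝ)) :=
        div_le_div_of_nonneg_left hn0.le (by positivity) (by linarith)
      have h6' : (y : ℝ) / h ≤ (y : ℝ) / 18 := div_le_div_of_nonneg_left hy0.le (by norm_num) hhr
      have h7 : ((2 * y - 3 : ℕ) : ℝ) / 28 + 1 - (y : ℝ) / 18 = (4 * (y : ℝ) + 225) / 252 := by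
        rw [hnr]
        ring
      have h8 : 0 ≤ (4 * (y : ℝ) + 225) / 252 := by positivity
      linarith [hπ, h5, h6', h7, h8]
  · -- FOUR SHIFTS on `(e^{L₁}, e^{Λ₀})`, `c₀ = 1`
    rw [not_le] at hmid
    have h59 : (144115188075855872 : ℝ) < ((2 * y - 3 : ℕ) : ℝ) := by
      have h1 : Real.exp L₁ < ((2 * y - 3 : ℕ) : ℝ) := by
        by_contra hc
        rw [not_lt] at hc
        have := Real.log_le_log hn0 hc
        rw [Real.log_exp] at this
        linarith
      exact lt_of_le_of_lt (numeral_le_exp_40.trans (Real.exp_le_exp.mpr h40)) h1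
    have h59n : 144115188075855872 < 2 * y - 3 := by exact_mod_cast h59
    have hy58 : (72057594037927936 : ℝ) ≤ (y : ℝ) := by
      have : 72057594037927936 ≤ y := by omega
      exact_mod_cast this
    have h2y0 : (0 : ℝ) < ((2 * y : ℕ) : ℝ) := by push_cast; linarith
    set L := Real.log ((2 * y : ℕ) : ℝ) with hLdef
    have hLΛ : L < Λ₀ := by
      have := Real.log_lt_log h2y0 hbig
      rwa [Real.log_exp] at this
    have hL₁L : L₁ ≤ L := by
      have h2y : ((2 * y - 3 : ℕ) : ℝ) ≤ ((2 * y : ℕ) : ℝ) := by rw [hnr]; push_cast; linarith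
      exact (hmid.trans_le (Real.log_le_log hn0 h2y)).le
    have hL40 : (40 : ℝ) ≤ L := h40.trans hL₁L
    have hLpos : (0 : ℝ) < L := by linarith
    have hL4 : L ≤ 10000 := by linarith
    have he40 : Real.exp 40 ≤ ((2 * y : ℕ) : ℝ) := by
      have : Real.exp 40 ≤ Real.exp L := Real.exp_le_exp.mpr hL40
      rwa [hLdef, Real.exp_log h2y0] at this
    have hπ : ∀ q : ℕ, q ≤ 41 → (2 * (y : ℝ) - q) / L ≤ (Nat.primeCounting (2 * y - q) : ℝ) := by
      intro q hq
      have hqr : (q : ℝ) ≤ 41 := by exact_mod_cast hq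
      have hnq : ((2 * y - q : ℕ) : ℝ) = 2 * (y : ℝ) - q := cast_two_mul_sub (by omega)
      have h67 : 67 ≤ 2 * y - q := by omega
      have hnq0 : (0 : ℝ) < ((2 * y - q : ℕ) : ℝ) := by rw [hnq]; linarith
      have hnq1 : (1 : ℝ) < ((2 * y - q : ℕ) : ℝ) := by rw [hnq]; linarith
      have h1 : 1 * ((2 * y - q : ℕ) : ℝ) / Real.log ((2 * y - q : ℕ) : ℝ)
          ≤ (Nat.primeCounting (2 * y - q) : ℝ) := by
        have := primeCountingLowerMul_one_of_RS hRS
        unfold PrimeCountingLowerMul at this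
        exact this (2 * y - q) h67
      rw [one_mul] at h1
      have hlogq0 : 0 < Real.log ((2 * y - q : ℕ) : ℝ) := Real.log_pos hnq1
      have hlogq : Real.log ((2 * y - q : ℕ) : ℝ) ≤ L := by
        have h2y : ((2 * y - q : ℕ) : ℝ) ≤ ((2 * y : ℕ) : ℝ) := by
          rw [hnq]; push_cast; linarith [Nat.cast_nonneg (α := ℝ) q]
        exact Real.log_le_log hnq0 h2y
      have h2 : (2 * (y : ℝ) - q) / L ≤ ((2 * y - q : ℕ) : ℝ) / Real.log ((2 * y - q : ℕ) : ℝ) := by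
        rw [← hnq]
        exact div_le_div_of_nonneg_left hnq0.le hlogq0 hlogq
      linarith
    have hP : ∀ d : ℕ, d ≠ 0 → Even d →
        (#((Nat.primesLE (2 * y)).filter (fun p => (p + d).Prime)) : ℝ)
          ≤ 17.09 * oddSingularFactor d * ((2 * y : ℕ) : ℝ) / L ^ 2 := by
      intro d hd hde
      exact pairCount_le_1709 (N := 2 * y) (h := d) he40 hd hde
    rcases le_or_gt L Lt with hmidt | hmidt
    · -- THREE SHIFTS `{3, 5, 7}` on `(e^{L₁}, e^{Lt}]`
      have hq := hquad3 L hL₁L hmidt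
      have hP2 := hP 2 (by norm_num) (by norm_num)
      have hP4 := hP 4 (by norm_num) (by norm_num)
      rw [oddSingularFactor_two'] at hP2
      rw [oddSingularFactor_four] at hP4
      have hcomb := three_shift_count (y := y) (by omega)
      have hcombr : (Nat.primeCounting (2 * y - 3) : ℝ) + Nat.primeCounting (2 * y - 5)
          + Nat.primeCounting (2 * y - 7)
          ≤ (#{b ∈ Ioc 0 y | b ∈ B} : ℝ) + 2
            + (2 * #((Nat.primesLE (2 * y)).filter (fun p => (p + 2).Prime))
              + #((Nat.primesLE (2 * y)).filter (fun p => (p + 4).Prime))) := by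
        exact_mod_cast hcomb
      have hπ3 := hπ 3 (by norm_num)
      have hπ5 := hπ 5 (by norm_num)
      have hπ7 := hπ 7 (by norm_num)
      push_cast at hπ3 hπ5 hπ7
      have h2yr : ((2 * y : ℕ) : ℝ) = 2 * (y : ℝ) := by push_cast; ring
      rw [h2yr] at hP2 hP4
      set G : ℝ := (#{b ∈ Ioc 0 y | b ∈ B} : ℝ) with hG
      set Y : ℝ := (y : ℝ) with hY
      have hG1 : (6 * Y - 15) / L - 2 - 102.54 * Y / L ^ 2 ≤ G := by
        have e1 : (6 * Y - 15) / L = (2 * Y - 3) / L + (2 * Y - 5) / L + (2 * Y - 7) / L := by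
          field_simp
          ring
        have e2 : 102.54 * Y / L ^ 2 = 2 * (17.09 * 1 * (2 * Y) / L ^ 2) + 17.09 * 1 * (2 * Y) / L ^ 2 := by
          field_simp
          ring
        rw [e1, e2]
        linarith [hcombr, hπ3, hπ5, hπ7, hP2, hP4]
      have hL2 : (0 : ℝ) < L ^ 2 := by positivity
      have hkey : Y * L ^ 2 ≤ (h : ℝ) * G * L ^ 2 := by
        have e3 : ((6 * Y - 15) / L - 2 - 102.54 * Y / L ^ 2) * L ^ 2
            = 6 * Y * L - 15 * L - 2 * L ^ 2 - 102.54 * Y := by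
          field_simp
        have h1 : (6 * Y * L - 15 * L - 2 * L ^ 2 - 102.54 * Y) * h ≤ G * L ^ 2 * h := by
          rw [← e3]
          exact mul_le_mul_of_nonneg_right (mul_le_mul_of_nonneg_right hG1 hL2.le) hh0.le
        have h2 : Y * (L ^ 2 + h) ≤ Y * (h * (6 * L - 102.54)) :=
          mul_le_mul_of_nonneg_left hq (by linarith)
        have h3 : 15 * L + 2 * L ^ 2 ≤ Y := by
          nlinarith [mul_nonneg (sub_nonneg.2 hL4) hLpos.le]
        have h3' : (h : ℝ) * (15 * L + 2 * L ^ 2) ≤ h * Y := mul_le_mul_of_nonneg_left h3 hh0.le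
        nlinarith [h1, h2, h3']
      have hfin := le_of_mul_le_mul_right hkey hL2
      rw [div_le_iff₀ hh0, mul_comm]
      exact hfin
    · rcases le_or_gt L L₂ with hmid2 | hmid2
      · -- FOUR SHIFTS on `(e^{Lt}, e^{L₂}]`
        have hq := hquad L hmidt.le hmid2
        have hP2 := hP 2 (by norm_num) (by norm_num)
        have hP4 := hP 4 (by norm_num) (by norm_num)
        have hP6 := hP 6 (by norm_num) (by norm_num)
        have hP8 := hP 8 (by norm_num) (by norm_num)
        rw [oddSingularFactor_two'] at hP2
        rw [oddSingularFactor_four] at hP4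
        rw [oddSingularFactor_six] at hP6
        rw [oddSingularFactor_eight] at hP8
        have hcomb := four_shift_count (y := y) (by omega)
        have hcombr : (Nat.primeCounting (2 * y - 3) : ℝ) + Nat.primeCounting (2 * y - 5)
            + Nat.primeCounting (2 * y - 7) + Nat.primeCounting (2 * y - 11)
            ≤ (#{b ∈ Ioc 0 y | b ∈ B} : ℝ) + 2
              + (2 * #((Nat.primesLE (2 * y)).filter (fun p => (p + 2).Prime))
                + 2 * #((Nat.primesLE (2 * y)).filter (fun p => (p + 4).Prime))
                + #((Nat.primesLE (2 * y)).filter (fun p => (p + 8).Prime))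
                + #((Nat.primesLE (2 * y)).filter (fun p => (p + 6).Prime))) := by
          exact_mod_cast hcomb
        have hπ3 := hπ 3 (by norm_num)
        have hπ5 := hπ 5 (by norm_num)
        have hπ7 := hπ 7 (by norm_num)
        have hπ11 := hπ 11 (by norm_num)
        push_cast at hπ3 hπ5 hπ7 hπ11
        have h2yr : ((2 * y : ℕ) : ℝ) = 2 * (y : ℝ) := by push_cast; ring
        rw [h2yr] at hP2 hP4 hP6 hP8
        set G : ℝ := (#{b ∈ Ioc 0 y | b ∈ B} : ℝ) with hG
        set Y : ℝ := (y : ℝ) with hY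
        have hG1 : (8 * Y - 26) / L - 2 - 239.26 * Y / L ^ 2 ≤ G := by
          have e1 : (8 * Y - 26) / L = (2 * Y - 3) / L + (2 * Y - 5) / L + (2 * Y - 7) / L + (2 * Y - 11) / L := by
            field_simp
            ring
          have e2 : 239.26 * Y / L ^ 2 = 2 * (17.09 * 1 * (2 * Y) / L ^ 2) + 2 * (17.09 * 1 * (2 * Y) / L ^ 2)
              + 17.09 * 1 * (2 * Y) / L ^ 2 + 17.09 * 2 * (2 * Y) / L ^ 2 := by
            field_simp
            ring
          rw [e1, e2]
          linarith [hcombr, hπ3, hπ5, hπ7, hπ11, hP2, hP4, hP6, hP8]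
        have hL2 : (0 : ℝ) < L ^ 2 := by positivity
        have hkey : Y * L ^ 2 ≤ (h : ℝ) * G * L ^ 2 := by
          have e3 : ((8 * Y - 26) / L - 2 - 239.26 * Y / L ^ 2) * L ^ 2
              = 8 * Y * L - 26 * L - 2 * L ^ 2 - 239.26 * Y := by
            field_simp
          have h1 : (8 * Y * L - 26 * L - 2 * L ^ 2 - 239.26 * Y) * h ≤ G * L ^ 2 * h := by
            rw [← e3]
            exact mul_le_mul_of_nonneg_right (mul_le_mul_of_nonneg_right hG1 hL2.le) hh0.le
          have h2 : Y * (L ^ 2 + h) ≤ Y * (h * (8 * L - 239.26)) :=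
            mul_le_mul_of_nonneg_left hq (by linarith)
          have h3 : 26 * L + 2 * L ^ 2 ≤ Y := by
            nlinarith [mul_nonneg (sub_nonneg.2 hL4) hLpos.le]
          have h3' : (h : ℝ) * (26 * L + 2 * L ^ 2) ≤ h * Y := mul_le_mul_of_nonneg_left h3 hh0.le
          nlinarith [h1, h2, h3']
        have hfin := le_of_mul_le_mul_right hkey hL2
        rw [div_le_iff₀ hh0, mul_comm]
        exact hfin
      · rcases le_or_gt L L₃ with hmid3 | hmid3
        · -- SEVEN SHIFTS on `(e^{L₂}, e^{L₃}]`
          have hq := hquad7 L hmid2.le hmid3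
          have he118 : Real.exp 118 ≤ ((2 * y : ℕ) : ℝ) := by
            have : Real.exp 118 ≤ Real.exp L := Real.exp_le_exp.mpr (hL₂.trans hmid2.le)
            rwa [hLdef, Real.exp_log h2y0] at this
          have hP7 : ∀ d : ℕ, d ≠ 0 → Even d →
              (#((Nat.primesLE (2 * y)).filter (fun p => (p + d).Prime)) : ℝ)
                ≤ 13.23 * oddSingularFactor d * ((2 * y : ℕ) : ℝ) / L ^ 2 := by
            intro d hd hde
            rw [hLdef]
            exact pairCount_le_1323 (N := 2 * y) (h := d) he118 hd hde
          have hP2 := hP7 2 (by norm_num) (by norm_num)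
          have hP4 := hP7 4 (by norm_num) (by norm_num)
          have hP6 := hP7 6 (by norm_num) (by norm_num)
          have hP8 := hP7 8 (by norm_num) (by norm_num)
          have hP10 := hP7 10 (by norm_num) (by norm_num)
          have hP12 := hP7 12 (by norm_num) (by norm_num)
          have hP14 := hP7 14 (by norm_num) (by norm_num)
          have hP16 := hP7 16 (by norm_num) (by norm_num)
          rw [oddSingularFactor_two'] at hP2
          rw [oddSingularFactor_four] at hP4
          rw [oddSingularFactor_six] at hP6
          rw [oddSingularFactor_eight] at hP8
          rw [oddSingularFactor_ten] at hP10
          rw [oddSingularFactor_twelve] at hP12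
          rw [oddSingularFactor_fourteen] at hP14
          rw [oddSingularFactor_sixteen] at hP16
          have hcomb := seven_shift_count (y := y) (by omega)
          have hcombr : (Nat.primeCounting (2 * y - 3) : ℝ) + Nat.primeCounting (2 * y - 5)
              + Nat.primeCounting (2 * y - 7) + Nat.primeCounting (2 * y - 11) + Nat.primeCounting (2 * y - 13)
              + Nat.primeCounting (2 * y - 17) + Nat.primeCounting (2 * y - 19)
              ≤ (#{b ∈ Ioc 0 y | b ∈ B} : ℝ) + 5
                + (4 * #((Nat.primesLE (2 * y)).filter (fun p => (p + 2).Prime))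
                  + 3 * #((Nat.primesLE (2 * y)).filter (fun p => (p + 4).Prime))
                  + 4 * #((Nat.primesLE (2 * y)).filter (fun p => (p + 6).Prime))
                  + 3 * #((Nat.primesLE (2 * y)).filter (fun p => (p + 8).Prime))
                  + 2 * #((Nat.primesLE (2 * y)).filter (fun p => (p + 10).Prime))
                  + 2 * #((Nat.primesLE (2 * y)).filter (fun p => (p + 12).Prime))
                  + 2 * #((Nat.primesLE (2 * y)).filter (fun p => (p + 14).Prime))
                  + #((Nat.primesLE (2 * y)).filter (fun p => (p + 16).Prime))) := by
            exact_mod_cast hcomb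
          have hπ3 := hπ 3 (by norm_num)
          have hπ5 := hπ 5 (by norm_num)
          have hπ7 := hπ 7 (by norm_num)
          have hπ11 := hπ 11 (by norm_num)
          have hπ13 := hπ 13 (by norm_num)
          have hπ17 := hπ 17 (by norm_num)
          have hπ19 := hπ 19 (by norm_num)
          push_cast at hπ3 hπ5 hπ7 hπ11 hπ13 hπ17 hπ19
          have h2yr : ((2 * y : ℕ) : ℝ) = 2 * (y : ℝ) := by push_cast; ring
          rw [h2yr] at hP2 hP4 hP6 hP8 hP10 hP12 hP14 hP16
          set G : ℝ := (#{b ∈ Ioc 0 y | b ∈ B} : ℝ) with hG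
          set Y : ℝ := (y : ℝ) with hY
          have hY0 : 0 ≤ Y := le_trans (by norm_num) hy58
          have hL2 : (0 : ℝ) < L ^ 2 := by positivity
          have hG1 : (14 * Y - 75) / L - 5 - 742.7 * Y / L ^ 2 ≤ G := by
            have e1 : (14 * Y - 75) / L
                = (2 * Y - 3) / L + (2 * Y - 5) / L + (2 * Y - 7) / L + (2 * Y - 11) / L + (2 * Y - 13) / L + (2 * Y - 17) / L + (2 * Y - 19) / L := by
              field_simp
              ring
            have e2 : 4 * (13.23 * 1 * (2 * Y) / L ^ 2) + 3 * (13.23 * 1 * (2 * Y) / L ^ 2)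
                + 4 * (13.23 * 2 * (2 * Y) / L ^ 2) + 3 * (13.23 * 1 * (2 * Y) / L ^ 2)
                + 2 * (13.23 * (4 / 3) * (2 * Y) / L ^ 2) + 2 * (13.23 * 2 * (2 * Y) / L ^ 2)
                + 2 * (13.23 * (6 / 5) * (2 * Y) / L ^ 2) + 13.23 * 1 * (2 * Y) / L ^ 2
                = (185661 / 250) * Y / L ^ 2 := by
              field_simp
              ring
            have e3 : (185661 / 250 : ℝ) * Y / L ^ 2 ≤ 742.7 * Y / L ^ 2 :=
              div_le_div_of_nonneg_right (mul_le_mul_of_nonneg_right (by norm_num) hY0) hL2.le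
            rw [e1]
            linarith [hcombr, hπ3, hπ5, hπ7, hπ11, hπ13, hπ17, hπ19, hP2, hP4, hP6, hP8, hP10, hP12, hP14, hP16,
              e2, e3]
          have hkey : Y * L ^ 2 ≤ (h : ℝ) * G * L ^ 2 := by
            have e4 : ((14 * Y - 75) / L - 5 - 742.7 * Y / L ^ 2) * L ^ 2
                = 14 * Y * L - 75 * L - 5 * L ^ 2 - 742.7 * Y := by
              field_simp
            have h1 : (14 * Y * L - 75 * L - 5 * L ^ 2 - 742.7 * Y) * h ≤ G * L ^ 2 * h := by
              rw [← e4]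
              exact mul_le_mul_of_nonneg_right (mul_le_mul_of_nonneg_right hG1 hL2.le) hh0.le
            have h2 : Y * (L ^ 2 + h) ≤ Y * (h * (14 * L - 742.7)) :=
              mul_le_mul_of_nonneg_left hq (by linarith)
            have h3 : 75 * L + 5 * L ^ 2 ≤ Y := by
              nlinarith [mul_nonneg (sub_nonneg.2 hL4) hLpos.le]
            have h3' : (h : ℝ) * (75 * L + 5 * L ^ 2) ≤ h * Y := mul_le_mul_of_nonneg_left h3 hh0.le
            nlinarith [h1, h2, h3']
          have hfin := le_of_mul_le_mul_right hkey hL2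
          rw [div_le_iff₀ hh0, mul_comm]
          exact hfin
        · -- TWELVE SHIFTS on `(e^{L₃}, e^{Λ₀})`, pair sieve at the threshold `e^215`
          have hq := hquad12 L hmid3.le hLΛ.le
          have he207 : Real.exp 207 ≤ ((2 * y : ℕ) : ℝ) := by
            have : Real.exp 207 ≤ Real.exp L := Real.exp_le_exp.mpr (hL₃.trans hmid3.le)
            rwa [hLdef, Real.exp_log h2y0] at this
          have hPt : ∀ d : ℕ, d ≠ 0 → Even d →
              (#((Nat.primesLE (2 * y)).filter (fun p => (p + d).Prime)) : ℝ)
                ≤ 12.46 * oddSingularFactor d * ((2 * y : ℕ) : ℝ) / L ^ 2 := by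
            intro d hd hde
            rw [hLdef]
            exact pairCount_le_1246 (N := 2 * y) (h := d) he207 hd hde
          have hQ2 := hPt 2 (by norm_num) (by norm_num)
          have hQ4 := hPt 4 (by norm_num) (by norm_num)
          have hQ6 := hPt 6 (by norm_num) (by norm_num)
          have hQ8 := hPt 8 (by norm_num) (by norm_num)
          have hQ10 := hPt 10 (by norm_num) (by norm_num)
          have hQ12 := hPt 12 (by norm_num) (by norm_num)
          have hQ14 := hPt 14 (by norm_num) (by norm_num)
          have hQ16 := hPt 16 (by norm_num) (by norm_num)
          have hQ18 := hPt 18 (by norm_num) (by norm_num)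
          have hQ20 := hPt 20 (by norm_num) (by norm_num)
          have hQ22 := hPt 22 (by norm_num) (by norm_num)
          have hQ24 := hPt 24 (by norm_num) (by norm_num)
          have hQ26 := hPt 26 (by norm_num) (by norm_num)
          have hQ28 := hPt 28 (by norm_num) (by norm_num)
          have hQ30 := hPt 30 (by norm_num) (by norm_num)
          have hQ32 := hPt 32 (by norm_num) (by norm_num)
          have hQ34 := hPt 34 (by norm_num) (by norm_num)
          have hQ36 := hPt 36 (by norm_num) (by norm_num)
          have hQ38 := hPt 38 (by norm_num) (by norm_num)
          rw [oddSingularFactor_two'] at hQ2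
          rw [oddSingularFactor_four] at hQ4
          rw [oddSingularFactor_six] at hQ6
          rw [oddSingularFactor_eight] at hQ8
          rw [oddSingularFactor_ten] at hQ10
          rw [oddSingularFactor_twelve] at hQ12
          rw [oddSingularFactor_fourteen] at hQ14
          rw [oddSingularFactor_sixteen] at hQ16
          rw [oddSingularFactor_eighteen] at hQ18
          rw [oddSingularFactor_twenty] at hQ20
          rw [oddSingularFactor_twentytwo] at hQ22
          rw [oddSingularFactor_twentyfour] at hQ24
          rw [oddSingularFactor_twentysix] at hQ26
          rw [oddSingularFactor_twentyeight] at hQ28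
          rw [oddSingularFactor_thirty] at hQ30
          rw [oddSingularFactor_thirtytwo] at hQ32
          rw [oddSingularFactor_thirtyfour] at hQ34
          rw [oddSingularFactor_thirtysix] at hQ36
          rw [oddSingularFactor_thirtyeight] at hQ38
          have hcomb := twelve_shift_count (y := y) (by omega)
          have hcombr : (Nat.primeCounting (2 * y - 3) : ℝ) + Nat.primeCounting (2 * y - 5)
              + Nat.primeCounting (2 * y - 7) + Nat.primeCounting (2 * y - 11) + Nat.primeCounting (2 * y - 13)
              + Nat.primeCounting (2 * y - 17) + Nat.primeCounting (2 * y - 19) + Nat.primeCounting (2 * y - 23)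
              + Nat.primeCounting (2 * y - 29) + Nat.primeCounting (2 * y - 31) + Nat.primeCounting (2 * y - 37)
              + Nat.primeCounting (2 * y - 41)
              ≤ (#{b ∈ Ioc 0 y | b ∈ (({0, 1} : Set ℕ) ∪ {m | ∃ p q : ℕ, p.Prime ∧ q.Prime ∧ p + q = 2 * m})} : ℝ) + 10
                + (5 * #((Nat.primesLE (2 * y)).filter (fun p => (p + 2).Prime))
                  + 5 * #((Nat.primesLE (2 * y)).filter (fun p => (p + 4).Prime))
                  + 7 * #((Nat.primesLE (2 * y)).filter (fun p => (p + 6).Prime))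
                  + 5 * #((Nat.primesLE (2 * y)).filter (fun p => (p + 8).Prime))
                  + 5 * #((Nat.primesLE (2 * y)).filter (fun p => (p + 10).Prime))
                  + 6 * #((Nat.primesLE (2 * y)).filter (fun p => (p + 12).Prime))
                  + 4 * #((Nat.primesLE (2 * y)).filter (fun p => (p + 14).Prime))
                  + 3 * #((Nat.primesLE (2 * y)).filter (fun p => (p + 16).Prime))
                  + 5 * #((Nat.primesLE (2 * y)).filter (fun p => (p + 18).Prime))
                  + 3 * #((Nat.primesLE (2 * y)).filter (fun p => (p + 20).Prime))
                  + 2 * #((Nat.primesLE (2 * y)).filter (fun p => (p + 22).Prime))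
                  + 4 * #((Nat.primesLE (2 * y)).filter (fun p => (p + 24).Prime))
                  + 3 * #((Nat.primesLE (2 * y)).filter (fun p => (p + 26).Prime))
                  + 2 * #((Nat.primesLE (2 * y)).filter (fun p => (p + 28).Prime))
                  + 2 * #((Nat.primesLE (2 * y)).filter (fun p => (p + 30).Prime))
                  + #((Nat.primesLE (2 * y)).filter (fun p => (p + 32).Prime))
                  + 2 * #((Nat.primesLE (2 * y)).filter (fun p => (p + 34).Prime))
                  + #((Nat.primesLE (2 * y)).filter (fun p => (p + 36).Prime))
                  + #((Nat.primesLE (2 * y)).filter (fun p => (p + 38).Prime))) := by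
            exact_mod_cast hcomb
          have hπ3 := hπ 3 (by norm_num)
          have hπ5 := hπ 5 (by norm_num)
          have hπ7 := hπ 7 (by norm_num)
          have hπ11 := hπ 11 (by norm_num)
          have hπ13 := hπ 13 (by norm_num)
          have hπ17 := hπ 17 (by norm_num)
          have hπ19 := hπ 19 (by norm_num)
          have hπ23 := hπ 23 (by norm_num)
          have hπ29 := hπ 29 (by norm_num)
          have hπ31 := hπ 31 (by norm_num)
          have hπ37 := hπ 37 (by norm_num)
          have hπ41 := hπ 41 (by norm_num)
          push_cast at hπ3 hπ5 hπ7 hπ11 hπ13 hπ17 hπ19 hπ23 hπ29 hπ31 hπ37 hπ41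
          have h2yr : ((2 * y : ℕ) : ℝ) = 2 * (y : ℝ) := by push_cast; ring
          rw [h2yr] at hQ2 hQ4 hQ6 hQ8 hQ10 hQ12 hQ14 hQ16 hQ18 hQ20 hQ22 hQ24 hQ26 hQ28 hQ30 hQ32 hQ34 hQ36 hQ38
          set G : ℝ := (#{b ∈ Ioc 0 y | b ∈ (({0, 1} : Set ℕ) ∪ {m | ∃ p q : ℕ, p.Prime ∧ q.Prime ∧ p + q = 2 * m})} : ℝ) with hG
          set Y : ℝ := (y : ℝ) with hY
          have hY0 : 0 ≤ Y := le_trans (by norm_num) hy58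
          have hL2 : (0 : ℝ) < L ^ 2 := by positivity
          have hG1 : (24 * Y - 236) / L - 10 - 2415 * Y / L ^ 2 ≤ G := by
            have e1 : (24 * Y - 236) / L
                = (2 * Y - 3) / L + (2 * Y - 5) / L + (2 * Y - 7) / L + (2 * Y - 11) / L
                  + (2 * Y - 13) / L + (2 * Y - 17) / L + (2 * Y - 19) / L + (2 * Y - 23) / L
                  + (2 * Y - 29) / L + (2 * Y - 31) / L + (2 * Y - 37) / L + (2 * Y - 41) / L := by
              field_simp
              ring
            have e2 : 5 * (12.46 * 1 * (2 * Y) / L ^ 2)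
                + 5 * (12.46 * 1 * (2 * Y) / L ^ 2)
                + 7 * (12.46 * 2 * (2 * Y) / L ^ 2)
                + 5 * (12.46 * 1 * (2 * Y) / L ^ 2)
                + 5 * (12.46 * (4 / 3) * (2 * Y) / L ^ 2)
                + 6 * (12.46 * 2 * (2 * Y) / L ^ 2)
                + 4 * (12.46 * (6 / 5) * (2 * Y) / L ^ 2)
                + 3 * (12.46 * 1 * (2 * Y) / L ^ 2)
                + 5 * (12.46 * 2 * (2 * Y) / L ^ 2)
                + 3 * (12.46 * (4 / 3) * (2 * Y) / L ^ 2)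
                + 2 * (12.46 * (10 / 9) * (2 * Y) / L ^ 2)
                + 4 * (12.46 * 2 * (2 * Y) / L ^ 2)
                + 3 * (12.46 * (12 / 11) * (2 * Y) / L ^ 2)
                + 2 * (12.46 * (6 / 5) * (2 * Y) / L ^ 2)
                + 2 * (12.46 * (8 / 3) * (2 * Y) / L ^ 2)
                + 12.46 * 1 * (2 * Y) / L ^ 2
                + 2 * (12.46 * (16 / 15) * (2 * Y) / L ^ 2)
                + 12.46 * 2 * (2 * Y) / L ^ 2
                + 12.46 * (18 / 17) * (2 * Y) / L ^ 2
                = (101587003 / 42075) * Y / L ^ 2 := by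
              field_simp
              ring
            have e3 : (101587003 / 42075 : ℝ) * Y / L ^ 2 ≤ 2415 * Y / L ^ 2 :=
              div_le_div_of_nonneg_right (mul_le_mul_of_nonneg_right (by norm_num) hY0) hL2.le
            rw [e1]
            linarith [hcombr, hπ3, hπ5, hπ7, hπ11, hπ13, hπ17, hπ19, hπ23, hπ29, hπ31, hπ37, hπ41,
              hQ2, hQ4, hQ6, hQ8, hQ10, hQ12, hQ14, hQ16, hQ18, hQ20, hQ22, hQ24, hQ26, hQ28, hQ30, hQ32, hQ34, hQ36, hQ38, e2, e3]
          have hkey : Y * L ^ 2 ≤ (h : ℝ) * G * L ^ 2 := by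
            have e4 : ((24 * Y - 236) / L - 10 - 2415 * Y / L ^ 2) * L ^ 2
                = 24 * Y * L - 236 * L - 10 * L ^ 2 - 2415 * Y := by
              field_simp
            have h1 : (24 * Y * L - 236 * L - 10 * L ^ 2 - 2415 * Y) * h ≤ G * L ^ 2 * h := by
              rw [← e4]
              exact mul_le_mul_of_nonneg_right (mul_le_mul_of_nonneg_right hG1 hL2.le) hh0.le
            have h2 : Y * (L ^ 2 + h) ≤ Y * (h * (24 * L - 2415)) :=
              mul_le_mul_of_nonneg_left hq (by linarith)
            have h3 : 236 * L + 10 * L ^ 2 ≤ Y := by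
              nlinarith [mul_nonneg (sub_nonneg.2 hL4) hLpos.le]
            have h3' : (h : ℝ) * (236 * L + 10 * L ^ 2) ≤ h * Y := mul_le_mul_of_nonneg_left h3 hh0.le
            nlinarith [h1, h2, h3']
          have hfin := le_of_mul_le_mul_right hkey hL2
          rw [div_le_iff₀ hh0, mul_comm]
          exact hfin

/-! ### §23.5 Instances: the count at `(Λs, Λ₀, A) = (324, 336, 12.09)`, the RS glue with `h = 20`, density, Mann -/

/-- **Under (3.3), above `e^336`**: at least `x/40` EVEN Goldbach numbers in `(0, x]` (`Λs = 324`, `A = 12.09`,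
`c₁ = 0.4995`; `(1/40)⁷·259.55·12.09⁸ = 0.7231 ≤ (0.4994·gHol4 336 − 0.0057)⁸ = 0.8209`).
[cite: RosserSchoenfeld1962, Theorem 2, eq. (3.3) (as input)] -/
theorem goldbach_even_count_ge_of_RS_40 (hRS : Literature.NumberTheory.LFunctions.RosserSchoenfeld1962_theorem2)
    {x : ℕ} (hx : Real.exp 336 ≤ (x : ℝ)) :
    (x : ℝ) / 40 ≤ #{N ∈ Ioc 0 x | Even N ∧ ∃ p q : ℕ, p.Prime ∧ q.Prime ∧ p + q = N} := by
  have h := goldbach_even_count_ge_holder400 (Λs := 324) (Λ₀ := 336) (A := 12.09) (c₁ := 0.4995) (κ := 1 / 40)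
    (by norm_num) (by norm_num) (by norm_num) (by norm_num) (by norm_num)
    (fun N hN hev => goldbachCount_le_1209 hN hev) (by norm_num) (by norm_num)
    (fun y hy => sum_goldbachCount_ge_of_RS' hRS ((Real.exp_le_exp.mpr (by norm_num)).trans hy))
    (by unfold gHol4; norm_num) (by unfold gHol4; norm_num) hx
  have e : (1 : ℝ) / 40 * x = x / 40 := by ring
  rw [e] at h
  exact h

/-- **Count for all `y ≥ 1` under (3.3)**: `B(y) ≥ y/20` (`L₁ = 40 = 2·20`, three shifts on `[40, 99]`, four on `[99, 118]`,
seven on `[118, 207]`, twelve on `[207, 336]`, count above `e^336`; windows `[20.9, 99.1]`, `[40.07, 119.93]`, `[71.3, 208.7]`,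
`[143.7, 336.3]`). [cite: RosserSchoenfeld1962, Theorem 2, eq. (3.3) (as input)] -/
theorem half_count_ge_allN_of_RS_20 (hRS : Literature.NumberTheory.LFunctions.RosserSchoenfeld1962_theorem2)
    {y : ℕ} (hy : 1 ≤ y) :
    (y : ℝ) / 20 ≤ #{b ∈ Ioc 0 y | b ∈ (({0, 1} : Set ℕ) ∪ {m | ∃ p q : ℕ, p.Prime ∧ q.Prime ∧ p + q = 2 * m})} := by
  have h := half_count_ge_allN_three_RS hRS (L₁ := 40) (Lt := 99) (L₂ := 118) (L₃ := 207) (Λ₀ := 336) (h := 20)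
    (by norm_num) (by norm_num) (by norm_num) (by norm_num) (by norm_num) (by norm_num)
    (fun L h1 h2 => by
      push_cast
      nlinarith [mul_nonneg (sub_nonneg.2 h1) (sub_nonneg.2 h2)])
    (fun L h1 h2 => by
      push_cast
      nlinarith [mul_nonneg (sub_nonneg.2 h1) (sub_nonneg.2 h2)])
    (fun L h1 h2 => by
      push_cast
      nlinarith [mul_nonneg (sub_nonneg.2 h1) (sub_nonneg.2 h2)])
    (fun L h1 h2 => by
      push_cast
      nlinarith [mul_nonneg (sub_nonneg.2 h1) (sub_nonneg.2 h2)])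
    (fun x hx => by
      have h1 := goldbach_even_count_ge_of_RS_40 hRS hx
      have e : (x : ℝ) / (2 * ((20 : ℕ) : ℝ)) = (x : ℝ) / 40 := by norm_num
      rw [e]
      exact h1) hy
  exact_mod_cast h

/-- **The halved density under (3.3), `1/20`**. [cite: RosserSchoenfeld1962, Theorem 2, eq. (3.3) (as input)] -/
theorem schnirelmannDensity_half_ge_of_RS_20 (hRS : Literature.NumberTheory.LFunctions.RosserSchoenfeld1962_theorem2) :
    (1 : ℝ) / 20 ≤ schnirelmannDensity
      (({0, 1} : Set ℕ) ∪ {m | ∃ p q : ℕ, p.Prime ∧ q.Prime ∧ p + q = 2 * m}) := by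
  have h := schnirelmannDensity_ge_of_count' (K := 20)
    (S := ({0, 1} : Set ℕ) ∪ {m | ∃ p q : ℕ, p.Prime ∧ q.Prime ∧ p + q = 2 * m})
    (fun N hN => by have := half_count_ge_allN_of_RS_20 hRS hN; exact_mod_cast this)
  exact_mod_cast h

/-- ★★★★★★★★★★★★★★★★ **Under Rosser–Schoenfeld (3.3): every integer `N ≥ 2` is a sum of at most `41` primes** (ROUND-39
«THREE»: a fifth glue regime with the three shifts `{3,5,7}` (pair weight `3` instead of `7`) from `e^40`, the enlarged-cell
pair sieve re-run from `e^40` (`17.09`), `e^118` (`13.23`), `e^207` (`12.46`), the count `x/40` above `e^336` (`A = 12.09` at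
`e^324`), `h = 20`, Mann `2·20 + 1`).
[cite: RosserSchoenfeld1962, Theorem 2, eq. (3.3) (as input); Nathanson1996, Thm 7.9] -/
theorem schnirelmann_goldbach_of_RS_le_41 (hRS : Literature.NumberTheory.LFunctions.RosserSchoenfeld1962_theorem2)
    (N : ℕ) (hN : 2 ≤ N) :
    ∃ M : Multiset ℕ, (∀ p ∈ M, p.Prime) ∧ Multiset.card M ≤ 41 ∧ M.sum = N := by
  have hσ : (1 : ℝ) / ((20 : ℕ) : ℝ) ≤ schnirelmannDensity
      (({0, 1} : Set ℕ) ∪ {m | ∃ p q : ℕ, p.Prime ∧ q.Prime ∧ p + q = 2 * m}) := by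
    have := schnirelmannDensity_half_ge_of_RS_20 hRS
    exact_mod_cast this
  exact sum_of_primes_of_half_density_mann (h := 20) (by norm_num) hσ N hN

/-! ## §24 ROUND-40 «CELLS-2»: the count sieve on the 68-cell polynomial `TlowK3`, `(x+2)/20 ≤ π(x)` below `10⁶`, and the
unconditional five-regime glue with `h = 22` -/

/-! ### §24.1 The explicit large-sieve step on `TlowK3` (`Λ ≥ 60`) -/

/-- `TlowK3` is increasing on `[3, ∞)` (`TlowK3 l − TlowK3 l₁ = (l − l₁)(0.3658(l + l₁) − 1.5193)`). [folklore] -/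
private theorem TlowK3_mono {l₁ l : ℝ} (h₁ : 3 ≤ l₁) (h : l₁ ≤ l) : TlowK3 l₁ ≤ TlowK3 l := by
  unfold TlowK3
  have h2 : (0 : ℝ) ≤ 0.3658 * (l + l₁) - 1.5193 := by linarith
  nlinarith [mul_nonneg (sub_nonneg.2 h) h2]

/-- `TlowK3(l₁) ≥ 100` for `l₁ ≥ 19.11` (`TlowK3(19.11) = 106.9`). [folklore] -/
private theorem TlowK3_ge {l₁ : ℝ} (h₁ : 19.11 ≤ l₁) : 100 ≤ TlowK3 l₁ := by
  unfold TlowK3; nlinarith [h₁, sq_nonneg (l₁ - 19.11)]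

set_option maxHeartbeats 1600000 in
/-- **The explicit large-sieve step on the 68-cell polynomial `TlowK3`** (ROUND-40; as `explicit_of_largeSieve_kappa2_c`
with `Λ ≥ max(60, 38.22 + 2·lc)`: `√N ≥ (L/2)^12/12! ≥ 10^9 ≥ 40·4194305` at `L ≥ 60`, so `X ≥ 2^22` and `Qsum_ge_kappa3`
applies; `TlowK3(l₁) ≥ 100` for `l₁ ≥ 19.11`).
[cite: BatemanDiamond2004, Thm 13.8, §13.4–13.5 pp. 325–328 (explicit form proved here)] -/
theorem explicit_of_largeSieve_kappa3_c {c : ℕ} {lc Λ A : ℝ} (hc4 : 4 ≤ c) (hc40 : c ≤ 40)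
    (hlc : (c : ℝ) * 1.00012 ≤ Real.exp lc) (hΛ : 60 ≤ Λ) (hΛc : 38.22 + 2 * lc ≤ Λ)
    (hA : ∀ L : ℝ, Λ ≤ L → ((c : ℝ) ^ 2 + 1) * L ^ 2
        ≤ (c : ℝ) ^ 2 * (A - 0.02) * TlowK3 (L / 2 - lc))
    {N : ℕ} {C F B : ℝ} (hN : Real.exp Λ ≤ (N : ℝ)) (hF1 : 1 ≤ F)
    (hB : B ≤ 2 * ((Nat.sqrt N / c : ℕ) : ℝ) + 2)
    (hBD : C * GoldbachSieveEight.Qsum ∅ (Nat.sqrt N / c) ≤ (((Nat.sqrt N / c : ℕ) : ℝ) ^ 2 + N - 1) * F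
      + B * GoldbachSieveEight.Qsum ∅ (Nat.sqrt N / c)) :
    C ≤ A * F * (N : ℝ) / Real.log (N : ℝ) ^ 2 := by
  have hN0 : (0 : ℝ) < N := lt_of_lt_of_le (Real.exp_pos Λ) hN
  set L := Real.log (N : ℝ) with hLdef
  have hL : Λ ≤ L := by
    have := Real.log_le_log (Real.exp_pos Λ) hN
    rwa [Real.log_exp] at this
  have hL60 : (60 : ℝ) ≤ L := le_trans hΛ hL
  have hL41 : (41 : ℝ) ≤ L := by linarith
  have hL2pos : 0 < L ^ 2 := by positivity
  have hcpos : 0 < c := by omega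
  have hc0 : (0 : ℝ) < c := by exact_mod_cast hcpos
  have hcR4 : (4 : ℝ) ≤ c := by exact_mod_cast hc4
  have hcR40 : (c : ℝ) ≤ 40 := by exact_mod_cast hc40
  -- E = √N = exp(L/2)
  set E := Real.exp (L / 2) with hEdef
  have hE0 : 0 < E := Real.exp_pos _
  have hE2 : E ^ 2 = N := by
    have : E ^ 2 = Real.exp L := by rw [hEdef, sq, ← Real.exp_add]; ring_nf
    rw [this, hLdef, Real.exp_log hN0]
  have hE8 : (L / 2) ^ 8 / 40320 ≤ E := by
    have := Real.pow_div_factorial_le_exp (L / 2) (by linarith) 8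
    simpa [Nat.factorial] using this
  have hLsq : (1681 : ℝ) ≤ L ^ 2 := by nlinarith [hL41]
  have hL4 : (1681 : ℝ) ^ 2 ≤ (L ^ 2) ^ 2 := pow_le_pow_left₀ (by norm_num) hLsq 2
  have hEL : 100 * L ^ 2 ≤ E := by
    have h1 : (1681 : ℝ) ^ 2 * 1681 * L ^ 2 ≤ (L ^ 2) ^ 2 * L ^ 2 * L ^ 2 := by
      have := mul_le_mul hL4 hLsq (by norm_num) (by positivity)
      nlinarith [this, hL2pos]
    have h2 : (L / 2) ^ 8 / 40320 = (L ^ 2) ^ 2 * L ^ 2 * L ^ 2 / 10321920 := by ring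
    rw [h2] at hE8
    nlinarith [h1, hE8]
  have hE12 : (L / 2) ^ 12 / 479001600 ≤ E := by
    have := Real.pow_div_factorial_le_exp (L / 2) (by linarith) 12
    simpa [Nat.factorial] using this
  have hEbig2 : (1000000000 : ℝ) ≤ E := by
    have h1 : ((30 : ℝ)) ^ 12 ≤ (L / 2) ^ 12 := pow_le_pow_left₀ (by norm_num) (by linarith) 12
    have h2 : ((30 : ℝ)) ^ 12 / 479001600 ≤ E := le_trans (div_le_div_of_nonneg_right h1 (by norm_num)) hE12
    norm_num at h2
    linarith
  -- s = ⌊√N⌋, X = s / c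
  set s := Nat.sqrt N with hsdef
  set X := s / c with hXdef
  have hs2 : (s : ℝ) ^ 2 ≤ N := by exact_mod_cast Nat.sqrt_le' N
  have hs2' : (N : ℝ) < ((s : ℝ) + 1) ^ 2 := by exact_mod_cast Nat.lt_succ_sqrt' N
  have hsE : (s : ℝ) ≤ E := by
    have : (s : ℝ) ^ 2 ≤ E ^ 2 := by rw [hE2]; exact hs2
    exact (pow_le_pow_iff_left₀ (Nat.cast_nonneg s) hE0.le two_ne_zero).mp this
  have hEs : E < (s : ℝ) + 1 := by
    have : E ^ 2 < ((s : ℝ) + 1) ^ 2 := by rw [hE2]; exact hs2'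
    exact (pow_lt_pow_iff_left₀ hE0.le (by positivity) two_ne_zero).mp this
  have hXc : X * c ≤ s := Nat.div_mul_le_self s c
  have hXc' : s + 1 ≤ X * c + c := Nat.lt_div_mul_add hcpos
  have hXcR : (X : ℝ) * c ≤ s := by exact_mod_cast hXc
  have hXcR' : (s : ℝ) + 1 ≤ (X : ℝ) * c + c := by exact_mod_cast hXc'
  have hX0R : (0 : ℝ) ≤ X := Nat.cast_nonneg X
  have hXR : (X : ℝ) ^ 2 * (c : ℝ) ^ 2 ≤ (N : ℝ) := by
    have : ((X : ℝ) * c) ^ 2 ≤ (s : ℝ) ^ 2 := pow_le_pow_left₀ (by positivity) hXcR 2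
    nlinarith [hs2, this]
  have hXlo : E / c - 1 < (X : ℝ) := by
    have h1 : E < (X : ℝ) * c + c := by linarith [hEs, hXcR']
    rw [sub_lt_iff_lt_add, div_lt_iff₀ hc0]; linarith
  have hXhi : (X : ℝ) ≤ E / c := by
    rw [le_div_iff₀ hc0]; linarith [hsE, hXcR]
  have hEc : (4194305 : ℝ) ≤ E / c := by
    rw [le_div_iff₀ hc0]; nlinarith [hEbig2, hcR40]
  have hX0 : (0 : ℝ) < X := by linarith
  have hX262144 : 4194304 ≤ X := by
    have : (4194304 : ℝ) ≤ X := by linarith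
    exact_mod_cast this
  -- log X ≥ l₁ := L/2 − lc
  set l₁ := L / 2 - lc with hl₁def
  have hexp : Real.exp l₁ ≤ (X : ℝ) := by
    rw [hl₁def, Real.exp_sub]
    have hlc0 : (0 : ℝ) < (c : ℝ) * 1.00012 := by positivity
    have h1 : E / Real.exp lc ≤ E / ((c : ℝ) * 1.00012) :=
      div_le_div_of_nonneg_left hE0.le hlc0 hlc
    have h2 : E / ((c : ℝ) * 1.00012) ≤ E / c - 1 := by
      rw [show E / ((c : ℝ) * 1.00012) = E / c / 1.00012 by rw [div_div],
        div_le_iff₀ (by norm_num : (0 : ℝ) < 1.00012)]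
      linarith [hEc]
    linarith [hXlo]
  have hl : l₁ ≤ Real.log X := by
    rw [Real.le_log_iff_exp_le hX0]; exact hexp
  have hl₁ : (19.11 : ℝ) ≤ l₁ := by rw [hl₁def]; linarith
  -- Q ≥ TlowK3(log X) ≥ TlowK3(l₁) ≥ 100
  set Q := GoldbachSieveEight.Qsum ∅ X with hQdef
  have hQ : TlowK3 (Real.log X) ≤ Q := Qsum_ge_kappa3 hX262144
  have hQT : TlowK3 l₁ ≤ Q := le_trans (TlowK3_mono (by linarith) hl) hQ
  have hT₁ : (100 : ℝ) ≤ TlowK3 l₁ := TlowK3_ge hl₁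
  have hQpos : 0 < Q := by linarith
  have hF0 : 0 ≤ F := le_trans zero_le_one hF1
  have hC1 : C ≤ ((X : ℝ) ^ 2 + N - 1) * F / Q + B := by
    have : C * Q ≤ (((X : ℝ) ^ 2 + N - 1) * F / Q + B) * Q := by
      rw [add_mul, div_mul_cancel₀ _ hQpos.ne']
      exact hBD
    exact le_of_mul_le_mul_right this hQpos
  have hc2pos : (0 : ℝ) < (c : ℝ) ^ 2 := by positivity
  set K : ℝ := ((c : ℝ) ^ 2 + 1) / (c : ℝ) ^ 2 with hKdef
  have hK0 : 0 < K := by positivity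
  have hC2 : ((X : ℝ) ^ 2 + N - 1) * F / Q ≤ K * (N : ℝ) * F / TlowK3 l₁ := by
    have hnum0 : 0 ≤ K * (N : ℝ) * F := by positivity
    have hXN : (X : ℝ) ^ 2 ≤ (N : ℝ) / (c : ℝ) ^ 2 := by rw [le_div_iff₀ hc2pos]; exact hXR
    have hKN : (X : ℝ) ^ 2 + N - 1 ≤ K * N := by
      have : K * N = N / (c : ℝ) ^ 2 + N := by rw [hKdef]; field_simp; ring
      rw [this]; linarith
    have hnum : ((X : ℝ) ^ 2 + N - 1) * F ≤ K * (N : ℝ) * F := mul_le_mul_of_nonneg_right hKN hF0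
    calc ((X : ℝ) ^ 2 + N - 1) * F / Q ≤ K * (N : ℝ) * F / Q := div_le_div_of_nonneg_right hnum hQpos.le
      _ ≤ K * (N : ℝ) * F / TlowK3 l₁ :=
          div_le_div_of_nonneg_left hnum0 (by linarith) hQT
  -- main term
  have hmain : K * (N : ℝ) * F / TlowK3 l₁ ≤ (A - 0.02) * F * (N : ℝ) / L ^ 2 := by
    have hkey : ((c : ℝ) ^ 2 + 1) * L ^ 2 ≤ (c : ℝ) ^ 2 * (A - 0.02) * TlowK3 l₁ := hA L hL
    have hkey' : K * L ^ 2 ≤ (A - 0.02) * TlowK3 l₁ := by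
      rw [hKdef, div_mul_eq_mul_div, div_le_iff₀ hc2pos]
      linarith [hkey]
    rw [div_le_div_iff₀ (by linarith) hL2pos]
    have hNF : 0 ≤ (N : ℝ) * F := by positivity
    have h := mul_le_mul_of_nonneg_left hkey' hNF
    calc K * (N : ℝ) * F * L ^ 2 = (N : ℝ) * F * (K * L ^ 2) := by ring
      _ ≤ (N : ℝ) * F * ((A - 0.02) * TlowK3 l₁) := h
      _ = (A - 0.02) * F * (N : ℝ) * TlowK3 l₁ := by ring
  -- boundary term
  have htail : B ≤ 0.02 * F * (N : ℝ) / L ^ 2 := by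
    have h2 : (E / 4 + 1) * L ^ 2 ≤ 0.01 * (N : ℝ) := by
      rw [← hE2]; exact tail_numeric'' hL41 hEL
    have h3 : 0.02 * (N : ℝ) ≤ 0.02 * F * (N : ℝ) :=
      calc 0.02 * (N : ℝ) ≤ F * (0.02 * (N : ℝ)) := le_mul_of_one_le_left (by positivity) hF1
        _ = 0.02 * F * (N : ℝ) := by ring
    rw [le_div_iff₀ hL2pos]
    have h1 : B * L ^ 2 ≤ 2 * ((E / 4 + 1) * L ^ 2) := by
      have hEc4 : E / c ≤ E / 4 := div_le_div_of_nonneg_left hE0.le (by norm_num) hcR4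
      have : B ≤ 2 * (E / 4 + 1) := by linarith only [hB, hXhi, hEc4]
      nlinarith only [this, hL2pos]
    linarith only [h1, h2, h3]
  calc C ≤ ((X : ℝ) ^ 2 + N - 1) * F / Q + B := hC1
    _ ≤ K * (N : ℝ) * F / TlowK3 l₁ + B := by linarith only [hC2]
    _ ≤ (A - 0.02) * F * (N : ℝ) / L ^ 2 + 0.02 * F * (N : ℝ) / L ^ 2 := add_le_add hmain htail
    _ = A * F * (N : ℝ) / L ^ 2 := by ring

/-- **Explicit GOLDBACH sieve bound with length `⌊√N⌋/c` on `TlowK3`**: under the numerics of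
`explicit_of_largeSieve_kappa3_c`, `r(N) ≤ A·f(N)·N/log²N` for even `N ≥ e^Λ`. [cite: BatemanDiamond2004, §13.4 (13.13)–(13.14)] -/
theorem goldbachCount_le_of_numeric3_c {c : ℕ} {lc Λ A : ℝ} (hc4 : 4 ≤ c) (hc40 : c ≤ 40)
    (hlc : (c : ℝ) * 1.00012 ≤ Real.exp lc) (hΛ : 60 ≤ Λ) (hΛc : 38.22 + 2 * lc ≤ Λ)
    (hnum : ∀ L : ℝ, Λ ≤ L → ((c : ℝ) ^ 2 + 1) * L ^ 2
        ≤ (c : ℝ) ^ 2 * (A - 0.02) * TlowK3 (L / 2 - lc))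
    {N : ℕ} (hN : Real.exp Λ ≤ (N : ℝ)) (heven : Even N) :
    (SingularSeries.goldbachCount N : ℝ) ≤ A * oddSingularFactor N * (N : ℝ) / Real.log (N : ℝ) ^ 2 := by
  have h41 : Real.exp 41 ≤ (N : ℝ) := (Real.exp_le_exp.mpr (le_trans (by norm_num) hΛ)).trans hN
  have h20 : (2 : ℝ) ^ 20 ≤ (N : ℝ) := le_trans (by norm_num) (two_pow_59_le_exp_41.trans h41)
  have hX1 : 1 ≤ Nat.sqrt N / c := by
    have h20' : 2 ^ 20 ≤ N := by exact_mod_cast h20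
    have hs : 1024 ≤ Nat.sqrt N := by
      rw [Nat.le_sqrt]
      calc 1024 * 1024 = 2 ^ 20 := by norm_num
        _ ≤ N := h20'
    exact (Nat.le_div_iff_mul_le (by omega)).mpr (by omega)
  have hBD := GoldbachSieveEight.goldbachCount_mul_Qsum_le N (Nat.sqrt N / c) heven hX1
  have hprod : (∏ p ∈ (N.primeFactors.filter (2 < ·)), (((p : ℝ) - 1) / ((p : ℝ) - 2)))
      = oddSingularFactor N := rfl
  rw [hprod] at hBD
  exact explicit_of_largeSieve_kappa3_c hc4 hc40 hlc hΛ hΛc hnum hN (one_le_oddSingularFactor' _)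
    (by linarith) hBD

/-! ### §24.2 Numerics: the count constant `A = 11.70` from `e^327` (`c = 16`, `TlowK3`) -/

/-- `c = 16` numerics at `Λ = 327` on `TlowK3`: `257L² ≤ 256·11.68·TlowK3(L/2 − 2.7728)` for `L ≥ 327`. [folklore] -/
private theorem cells16_numeric3_327 {L : ℝ} (hL : 327 ≤ L) :
    (((16 : ℕ) : ℝ) ^ 2 + 1) * L ^ 2 ≤ ((16 : ℕ) : ℝ) ^ 2 * (11.70 - 0.02) * TlowK3 (L / 2 - 2.7728) := by
  unfold TlowK3
  push_cast
  nlinarith [hL, mul_self_nonneg (L - 327)]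

/-- **GOLDBACH SIEVE `11.70` above `e^327`** (`c = 16`, the 68 cells): `r(N) ≤ 11.70·f(N)·N/log²N` for even `N ≥ e^327`.
[cite: BatemanDiamond2004, §13.4 (13.13)–(13.14)] -/
theorem goldbachCount_le_1170 {N : ℕ} (hN : Real.exp 327 ≤ (N : ℝ)) (heven : Even N) :
    (SingularSeries.goldbachCount N : ℝ) ≤ 11.70 * oddSingularFactor N * (N : ℝ) / Real.log (N : ℝ) ^ 2 :=
  goldbachCount_le_of_numeric3_c (c := 16) (lc := 2.7728) (by norm_num) (by norm_num)
    (by have := exp_27728_ge; push_cast; linarith) (by norm_num) (by norm_num)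
    (fun _ hL => cells16_numeric3_327 hL) hN heven

/-! ### §24.3 Chebyshev pointwise with the constant `20`: `(x + 2)/20 ≤ π(x)` on `122 ≤ x`, `log x ≤ 14` -/

/-- `22000 ≤ e^10` (`e ≥ 2.7182818283`). [folklore] -/
private theorem exp_10_ge' : (22000 : ℝ) ≤ Real.exp 10 := by
  have he : (2.7182818283 : ℝ) ≤ Real.exp 1 := Real.exp_one_gt_d9.le
  have h10 : (2.7182818283 : ℝ) ^ 10 ≤ Real.exp 10 := by
    rw [show (10 : ℝ) = ((10 : ℕ) : ℝ) * 1 by norm_num, Real.exp_nat_mul]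
    exact pow_le_pow_left₀ (by norm_num) he 10
  exact le_trans (by norm_num) h10

/-- **Chebyshev, pointwise, constant `20`**: `(x + 2)/20 ≤ π(x)` for `122 ≤ x` with `log x ≤ 14` (from
`0.921292·x − 5 log x ≤ ψ(x) ≤ π(x) log x`; `log x ≤ 10` below `22000`: `0.5x + 1 < 0.921292x − 50` for `x ≥ 122`;
`log x ≤ 14` above: `0.7x + 1.4 < 0.921292x − 70`).  ONE input varied w.r.t. the tree's `primeCounting_ge_div45`: the
log-range `41 ↦ 14` (the lemma is only used below `10⁶`), which is what lets the one-shift regime serve `h = 22`.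
[cite: Chebyshev1852, §5 (constant A; via Diamond1982 §3)] -/
theorem primeCounting_ge_div20 {x : ℕ} (hx : 122 ≤ x) (hlog : Real.log (x : ℝ) ≤ 14) :
    ((x : ℝ) + 2) / 20 ≤ (Nat.primeCounting x : ℝ) := by
  have hxR : (122 : ℝ) ≤ x := by exact_mod_cast hx
  have hx1 : (1 : ℝ) < x := by linarith
  have hL : 0 < Real.log (x : ℝ) := Real.log_pos hx1
  have hψ := Literature.NumberTheory.LFunctions.ChebyshevExplicit.psi_ge_chebyshev (le_trans (by norm_num) hx)
  have hA := Literature.NumberTheory.LFunctions.ChebyshevExplicit.A_bounds.1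
  have hπ := Chebyshev.psi_le_primeCounting_mul_log x
  have hAx : 0.921292 * (x : ℝ) ≤ Literature.NumberTheory.LFunctions.ChebyshevExplicit.A * x :=
    mul_le_mul_of_nonneg_right hA (by positivity)
  have key : 0.921292 * (x : ℝ) - 5 * Real.log (x : ℝ) ≤ (Nat.primeCounting x : ℝ) * Real.log (x : ℝ) := by linarith
  have hP0 : (0 : ℝ) ≤ (Nat.primeCounting x : ℝ) := Nat.cast_nonneg _
  by_contra hcon
  rw [not_le] at hcon
  have hPL : (Nat.primeCounting x : ℝ) * Real.log (x : ℝ) ≤ ((x : ℝ) + 2) / 20 * Real.log (x : ℝ) :=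
    mul_le_mul_of_nonneg_right hcon.le hL.le
  by_cases hsmall : (x : ℝ) < 22000
  · have hL10 : Real.log (x : ℝ) ≤ 10 := by
      have h := Real.log_le_log (by linarith) (hsmall.le.trans exp_10_ge')
      rwa [Real.log_exp] at h
    have h3 : ((x : ℝ) + 2) / 20 * Real.log (x : ℝ) ≤ ((x : ℝ) + 2) / 20 * 10 :=
      mul_le_mul_of_nonneg_left hL10 (by positivity)
    nlinarith
  · rw [not_lt] at hsmall
    have h3 : ((x : ℝ) + 2) / 20 * Real.log (x : ℝ) ≤ ((x : ℝ) + 2) / 20 * 14 :=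
      mul_le_mul_of_nonneg_left hlog (by positivity)
    nlinarith

/-! ### §24.4 The unconditional five-regime glue -/

set_option maxHeartbeats 4000000 in
/-- **UNCONDITIONAL GLUE FOR ALL `y ≥ 1`, FIVE REGIMES, `h ≥ 22`** (ROUND-40 «CELLS-2»): one shift below `e^{L₁}`
(`L₁ ≤ 1.8424h`, `π(n) ≥ 0.9212 n/log n` above `10⁶`, `(n+2)/20 ≤ π(n)` on `[122, 10⁶)` — NEW, `primeCounting_ge_div20` —
and `π ≥ 2` below), THREE shifts `{3,5,7}` on `(e^{L₁}, e^{Lt}]` (`three_shift_count`, pair weight `2·17.09·3 = 102.54`,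
the `e^40` pair sieve `pairCount_le_1709`, Sylvester counts `0.93919·(2y−q)/L`), FOUR shifts on `(e^{Lt}, e^{L₂}]`
(weight `239.26`), SEVEN shifts on `(e^{L₂}, e^{L₃}]` (`pairCount_le_1323` from `e^118`, weight `185661/250 ≤ 742.7`), TWELVE
shifts on `(e^{L₃}, e^{Λ₀})` (`pairCount_le_1246` from `e^207`, weight `101587003/42075 ≤ 2415`), the count above `e^{Λ₀}`:
`L² + h ≤ h·(5.63514L − 102.54)` on `[L₁, Lt]`, `L² + h ≤ h·(7.51352L − 239.26)` on `[Lt, L₂]`,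
`L² + h ≤ h·(13.14866L − 742.7)` on `[L₂, L₃]`, `L² + h ≤ h·(22.54056L − 2415)` on `[L₃, Λ₀]`; requires `L₁ ≥ 40`. [cite: Nathanson1996, Theorem 7.8 (five-regime explicit form for the halved Goldbach set; proved here)] -/
theorem half_count_ge_allN_three {L₁ Lt L₂ L₃ Λ₀ : ℝ} {h : ℕ} (h22 : 22 ≤ h) (h40 : 40 ≤ L₁) (hL₁h : L₁ ≤ 1.8424 * h)
    (hL₂ : 118 ≤ L₂) (hL₃ : 207 ≤ L₃) (hΛ4 : Λ₀ ≤ 10000)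
    (hquad3 : ∀ L : ℝ, L₁ ≤ L → L ≤ Lt → L ^ 2 + h ≤ h * (5.63514 * L - 102.54))
    (hquad : ∀ L : ℝ, Lt ≤ L → L ≤ L₂ → L ^ 2 + h ≤ h * (7.51352 * L - 239.26))
    (hquad7 : ∀ L : ℝ, L₂ ≤ L → L ≤ L₃ → L ^ 2 + h ≤ h * (13.14866 * L - 742.7))
    (hquad12 : ∀ L : ℝ, L₃ ≤ L → L ≤ Λ₀ → L ^ 2 + h ≤ h * (22.54056 * L - 2415))
    (hlarge : ∀ x : ℕ, Real.exp Λ₀ ≤ (x : ℝ) →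
      (x : ℝ) / (2 * h) ≤ #{N ∈ Ioc 0 x | Even N ∧ ∃ p q : ℕ, p.Prime ∧ q.Prime ∧ p + q = N})
    {y : ℕ} (hy : 1 ≤ y) :
    (y : ℝ) / h ≤ #{b ∈ Ioc 0 y | b ∈ (({0, 1} : Set ℕ) ∪ {m | ∃ p q : ℕ, p.Prime ∧ q.Prime ∧ p + q = 2 * m})} := by
  set B : Set ℕ := ({0, 1} : Set ℕ) ∪ {m | ∃ p q : ℕ, p.Prime ∧ q.Prime ∧ p + q = 2 * m} with hB
  have hhr : (22 : ℝ) ≤ h := by exact_mod_cast h22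
  have hh0 : (0 : ℝ) < h := by linarith
  have hL₁pos : (0 : ℝ) < L₁ := by linarith
  by_cases hbig : Real.exp Λ₀ ≤ ((2 * y : ℕ) : ℝ)
  · have h1 := hlarge (2 * y) hbig
    have h2 := even_goldbach_card_le_half y
    have e : ((2 * y : ℕ) : ℝ) / (2 * h) = (y : ℝ) / h := by
      push_cast
      field_simp
    rw [e] at h1
    exact h1.trans (by exact_mod_cast h2)
  rw [not_le] at hbig
  by_cases hsmall : y ≤ h
  · have h1 : 1 ≤ #{b ∈ Ioc 0 y | b ∈ B} :=
      card_pos.mpr ⟨1, by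
        rw [mem_filter, mem_Ioc]
        exact ⟨⟨by omega, hy⟩, Or.inl (by simp)⟩⟩
    have h1' : (1 : ℝ) ≤ #{b ∈ Ioc 0 y | b ∈ B} := by exact_mod_cast h1
    have h2 : (y : ℝ) / h ≤ 1 := by
      rw [div_le_one hh0]
      exact_mod_cast hsmall
    linarith
  rw [not_le] at hsmall
  have hy29 : 23 ≤ y := by omega
  have hnr : ((2 * y - 3 : ℕ) : ℝ) = 2 * (y : ℝ) - 3 := cast_two_mul_sub_three (by omega)
  have hy29r : (23 : ℝ) ≤ y := by exact_mod_cast hy29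
  have hy0 : (0 : ℝ) < y := by linarith
  have hn55 : 43 ≤ 2 * y - 3 := by omega
  have hn0 : (0 : ℝ) < ((2 * y - 3 : ℕ) : ℝ) := by rw [hnr]; linarith
  have hn1 : (1 : ℝ) < ((2 * y - 3 : ℕ) : ℝ) := by rw [hnr]; linarith
  have hlogpos : 0 < Real.log ((2 * y - 3 : ℕ) : ℝ) := Real.log_pos hn1
  by_cases hmid : Real.log ((2 * y - 3 : ℕ) : ℝ) ≤ L₁
  · -- ONE SHIFT below `e^{L₁}` (§15)
    have hemb := primeCounting_shift_le_half_count (y := y) (by omega)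
    have hembr : (Nat.primeCounting (2 * y - 3) : ℝ) + 1 ≤ #{b ∈ Ioc 0 y | b ∈ B} := by exact_mod_cast hemb
    refine le_trans ?_ hembr
    by_cases h6 : 10 ^ 6 ≤ 2 * y - 3
    · have hπ : 0.9212 * ((2 * y - 3 : ℕ) : ℝ) / Real.log ((2 * y - 3 : ℕ) : ℝ)
          ≤ (Nat.primeCounting (2 * y - 3) : ℝ) := by
        have := primeCountingLowerMul_09212
        unfold PrimeCountingLowerMul at this
        exact this (2 * y - 3) h6
      have h2 : 0.9212 * ((2 * y - 3 : ℕ) : ℝ) / L₁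
          ≤ 0.9212 * ((2 * y - 3 : ℕ) : ℝ) / Real.log ((2 * y - 3 : ℕ) : ℝ) :=
        div_le_div_of_nonneg_left (by positivity) hlogpos hmid
      have h3 : (y : ℝ) / h ≤ 1.8424 * y / L₁ := by
        rw [div_le_div_iff₀ hh0 hL₁pos]
        nlinarith [mul_le_mul_of_nonneg_left hL₁h hy0.le]
      have h4 : 1.8424 * (y : ℝ) / L₁ ≤ 0.9212 * ((2 * y - 3 : ℕ) : ℝ) / L₁ + 1 := by
        rw [hnr]
        have e : 0.9212 * (2 * (y : ℝ) - 3) / L₁ = 1.8424 * y / L₁ - 2.7636 / L₁ := by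
          field_simp
          ring
        rw [e]
        have : 2.7636 / L₁ ≤ 1 := by
          rw [div_le_one hL₁pos]
          linarith
        linarith
      linarith [h2, h3, h4, hπ]
    · rw [not_le] at h6
      -- `2y − 3 < 10⁶`: Chebyshev pointwise `(n + 2)/20 ≤ π(n)` for `n ≥ 122` (§7.3), `π(n) ≥ π(3) = 2` below
      by_cases h88 : 122 ≤ 2 * y - 3
      · have hlog14 : Real.log ((2 * y - 3 : ℕ) : ℝ) ≤ 14 := log_le_14_of_lt (by omega) h6
        have hπ := primeCounting_ge_div20 h88 hlog14
        rw [hnr] at hπ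
        have h6' : (y : ℝ) / h ≤ (y : ℝ) / 22 := div_le_div_of_nonneg_left hy0.le (by norm_num) hhr
        have h7 : (y : ℝ) / 22 ≤ (2 * (y : ℝ) - 3 + 2) / 20 + 1 := by
          rw [div_le_iff₀ (by norm_num : (0 : ℝ) < 22)]
          linarith
        linarith [hπ, h6', h7]
      · rw [not_le] at h88
        have hπ3 : Nat.primeCounting 3 = 2 := by decide
        have hmono := Nat.monotone_primeCounting (show 3 ≤ 2 * y - 3 by omega)
        rw [hπ3] at hmono
        have hπ2 : (2 : ℝ) ≤ (Nat.primeCounting (2 * y - 3) : ℝ) := by exact_mod_cast hmono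
        have hy45 : (y : ℝ) ≤ 62 := by exact_mod_cast (show y ≤ 62 by omega)
        have h7 : (y : ℝ) / h ≤ 3 := by
          rw [div_le_iff₀ hh0]
          linarith
        linarith
  · -- SHIFTS on `(e^{L₁}, e^{Λ₀})`: three / four / seven / twelve
    rw [not_le] at hmid
    have h59 : (144115188075855872 : ℝ) < ((2 * y - 3 : ℕ) : ℝ) := by
      have h1 : Real.exp L₁ < ((2 * y - 3 : ℕ) : ℝ) := by
        by_contra hc
        rw [not_lt] at hc
        have := Real.log_le_log hn0 hc
        rw [Real.log_exp] at this
        linarith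
      exact lt_of_le_of_lt (numeral_le_exp_40.trans (Real.exp_le_exp.mpr h40)) h1
    have h59n : 144115188075855872 < 2 * y - 3 := by exact_mod_cast h59
    have hy58 : (72057594037927936 : ℝ) ≤ (y : ℝ) := by
      have : 72057594037927936 ≤ y := by omega
      exact_mod_cast this
    have h2y0 : (0 : ℝ) < ((2 * y : ℕ) : ℝ) := by push_cast; linarith
    set L := Real.log ((2 * y : ℕ) : ℝ) with hLdef
    have hLΛ : L < Λ₀ := by
      have := Real.log_lt_log h2y0 hbig
      rwa [Real.log_exp] at this
    have hL₁L : L₁ ≤ L := by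
      have h2y : ((2 * y - 3 : ℕ) : ℝ) ≤ ((2 * y : ℕ) : ℝ) := by rw [hnr]; push_cast; linarith
      exact (hmid.trans_le (Real.log_le_log hn0 h2y)).le
    have hL40 : (40 : ℝ) ≤ L := h40.trans hL₁L
    have hLpos : (0 : ℝ) < L := by linarith
    have hL4 : L ≤ 10000 := by linarith
    have he40 : Real.exp 40 ≤ ((2 * y : ℕ) : ℝ) := by
      have : Real.exp 40 ≤ Real.exp L := Real.exp_le_exp.mpr hL40
      rwa [hLdef, Real.exp_log h2y0] at this
    -- the prime counts, Sylvester's constant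
    have hπ : ∀ q : ℕ, q ≤ 41 → 0.93919 * (2 * (y : ℝ) - q) / L ≤ (Nat.primeCounting (2 * y - q) : ℝ) := by
      intro q hq
      have hqr : (q : ℝ) ≤ 41 := by exact_mod_cast hq
      have hnq : ((2 * y - q : ℕ) : ℝ) = 2 * (y : ℝ) - q := cast_two_mul_sub (by omega)
      have h6 : 10 ^ 12 ≤ 2 * y - q := by omega
      have hnq0 : (0 : ℝ) < ((2 * y - q : ℕ) : ℝ) := by rw [hnq]; linarith
      have hnq1 : (1 : ℝ) < ((2 * y - q : ℕ) : ℝ) := by rw [hnq]; linarith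
      have h1 : 0.93919 * ((2 * y - q : ℕ) : ℝ) / Real.log ((2 * y - q : ℕ) : ℝ)
          ≤ (Nat.primeCounting (2 * y - q) : ℝ) := by
        have := primeCountingLowerMul_sylvester
        unfold PrimeCountingLowerMul at this
        exact this (2 * y - q) h6
      have hlogq0 : 0 < Real.log ((2 * y - q : ℕ) : ℝ) := Real.log_pos hnq1
      have hlogq : Real.log ((2 * y - q : ℕ) : ℝ) ≤ L := by
        have h2y : ((2 * y - q : ℕ) : ℝ) ≤ ((2 * y : ℕ) : ℝ) := by
          rw [hnq]; push_cast; linarith [Nat.cast_nonneg (α := ℝ) q]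
        exact Real.log_le_log hnq0 h2y
      have h2 : 0.93919 * (2 * (y : ℝ) - q) / L
          ≤ 0.93919 * ((2 * y - q : ℕ) : ℝ) / Real.log ((2 * y - q : ℕ) : ℝ) := by
        rw [← hnq]
        exact div_le_div_of_nonneg_left (by positivity) hlogq0 hlogq
      linarith
    -- the pair counts (the enlarged-cell pair sieve above `e^40`, ROUND-39)
    have hP : ∀ d : ℕ, d ≠ 0 → Even d →
        (#((Nat.primesLE (2 * y)).filter (fun p => (p + d).Prime)) : ℝ)
          ≤ 17.09 * oddSingularFactor d * ((2 * y : ℕ) : ℝ) / L ^ 2 := by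
      intro d hd hde
      exact pairCount_le_1709 (N := 2 * y) (h := d) he40 hd hde
    rcases le_or_gt L Lt with hmidt | hmidt
    · -- THREE SHIFTS `{3, 5, 7}` on `(e^{L₁}, e^{Lt}]`
      have hq := hquad3 L hL₁L hmidt
      have hP2 := hP 2 (by norm_num) (by norm_num)
      have hP4 := hP 4 (by norm_num) (by norm_num)
      rw [oddSingularFactor_two'] at hP2
      rw [oddSingularFactor_four] at hP4
      have hcomb := three_shift_count (y := y) (by omega)
      have hcombr : (Nat.primeCounting (2 * y - 3) : ℝ) + Nat.primeCounting (2 * y - 5)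
          + Nat.primeCounting (2 * y - 7)
          ≤ (#{b ∈ Ioc 0 y | b ∈ B} : ℝ) + 2
            + (2 * #((Nat.primesLE (2 * y)).filter (fun p => (p + 2).Prime))
              + #((Nat.primesLE (2 * y)).filter (fun p => (p + 4).Prime))) := by
        exact_mod_cast hcomb
      have hπ3 := hπ 3 (by norm_num)
      have hπ5 := hπ 5 (by norm_num)
      have hπ7 := hπ 7 (by norm_num)
      push_cast at hπ3 hπ5 hπ7
      have h2yr : ((2 * y : ℕ) : ℝ) = 2 * (y : ℝ) := by push_cast; ring
      rw [h2yr] at hP2 hP4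
      set G : ℝ := (#{b ∈ Ioc 0 y | b ∈ B} : ℝ) with hG
      set Y : ℝ := (y : ℝ) with hY
      -- `G ≥ (5.63514 Y − 14.08785)/L − 2 − 102.54 Y/L²`
      have hG1 : (5.63514 * Y - 14.08785) / L - 2 - 102.54 * Y / L ^ 2 ≤ G := by
        have e1 : (5.63514 * Y - 14.08785) / L = 0.93919 * (2 * Y - 3) / L + 0.93919 * (2 * Y - 5) / L
            + 0.93919 * (2 * Y - 7) / L := by
          field_simp
          ring
        have e2 : 102.54 * Y / L ^ 2 = 2 * (17.09 * 1 * (2 * Y) / L ^ 2) + 17.09 * 1 * (2 * Y) / L ^ 2 := by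
          field_simp
          ring
        rw [e1, e2]
        linarith [hcombr, hπ3, hπ5, hπ7, hP2, hP4]
      have hL2 : (0 : ℝ) < L ^ 2 := by positivity
      have hkey : Y * L ^ 2 ≤ (h : ℝ) * G * L ^ 2 := by
        have e3 : ((5.63514 * Y - 14.08785) / L - 2 - 102.54 * Y / L ^ 2) * L ^ 2
            = 5.63514 * Y * L - 14.08785 * L - 2 * L ^ 2 - 102.54 * Y := by
          field_simp
        have h1 : (5.63514 * Y * L - 14.08785 * L - 2 * L ^ 2 - 102.54 * Y) * h ≤ G * L ^ 2 * h := by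
          rw [← e3]
          exact mul_le_mul_of_nonneg_right (mul_le_mul_of_nonneg_right hG1 hL2.le) hh0.le
        have h2 : Y * (L ^ 2 + h) ≤ Y * (h * (5.63514 * L - 102.54)) :=
          mul_le_mul_of_nonneg_left hq (by linarith)
        have h3 : 14.08785 * L + 2 * L ^ 2 ≤ Y := by
          nlinarith [mul_nonneg (sub_nonneg.2 hL4) hLpos.le]
        have h3' : (h : ℝ) * (14.08785 * L + 2 * L ^ 2) ≤ h * Y := mul_le_mul_of_nonneg_left h3 hh0.le
        nlinarith [h1, h2, h3']
      have hfin := le_of_mul_le_mul_right hkey hL2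
      rw [div_le_iff₀ hh0, mul_comm]
      exact hfin
    · rcases le_or_gt L L₂ with hmid2 | hmid2
      · -- FOUR SHIFTS on `(e^{Lt}, e^{L₂}]`
        have hq := hquad L hmidt.le hmid2
        have hP2 := hP 2 (by norm_num) (by norm_num)
        have hP4 := hP 4 (by norm_num) (by norm_num)
        have hP6 := hP 6 (by norm_num) (by norm_num)
        have hP8 := hP 8 (by norm_num) (by norm_num)
        rw [oddSingularFactor_two'] at hP2
        rw [oddSingularFactor_four] at hP4
        rw [oddSingularFactor_six] at hP6
        rw [oddSingularFactor_eight] at hP8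
        -- combinatorics
        have hcomb := four_shift_count (y := y) (by omega)
        have hcombr : (Nat.primeCounting (2 * y - 3) : ℝ) + Nat.primeCounting (2 * y - 5)
            + Nat.primeCounting (2 * y - 7) + Nat.primeCounting (2 * y - 11)
            ≤ (#{b ∈ Ioc 0 y | b ∈ B} : ℝ) + 2
              + (2 * #((Nat.primesLE (2 * y)).filter (fun p => (p + 2).Prime))
                + 2 * #((Nat.primesLE (2 * y)).filter (fun p => (p + 4).Prime))
                + #((Nat.primesLE (2 * y)).filter (fun p => (p + 8).Prime))
                + #((Nat.primesLE (2 * y)).filter (fun p => (p + 6).Prime))) := by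
          exact_mod_cast hcomb
        have hπ3 := hπ 3 (by norm_num)
        have hπ5 := hπ 5 (by norm_num)
        have hπ7 := hπ 7 (by norm_num)
        have hπ11 := hπ 11 (by norm_num)
        push_cast at hπ3 hπ5 hπ7 hπ11
        have h2yr : ((2 * y : ℕ) : ℝ) = 2 * (y : ℝ) := by push_cast; ring
        rw [h2yr] at hP2 hP4 hP6 hP8
        set G : ℝ := (#{b ∈ Ioc 0 y | b ∈ B} : ℝ) with hG
        set Y : ℝ := (y : ℝ) with hY
        -- `G ≥ (7.51352 Y − 24.41894)/L − 2 − 239.26 Y/L²`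
        have hG1 : (7.51352 * Y - 24.41894) / L - 2 - 239.26 * Y / L ^ 2 ≤ G := by
          have e1 : (7.51352 * Y - 24.41894) / L = 0.93919 * (2 * Y - 3) / L + 0.93919 * (2 * Y - 5) / L
              + 0.93919 * (2 * Y - 7) / L + 0.93919 * (2 * Y - 11) / L := by
            field_simp
            ring
          have e2 : 239.26 * Y / L ^ 2 = 2 * (17.09 * 1 * (2 * Y) / L ^ 2) + 2 * (17.09 * 1 * (2 * Y) / L ^ 2)
              + 17.09 * 1 * (2 * Y) / L ^ 2 + 17.09 * 2 * (2 * Y) / L ^ 2 := by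
            field_simp
            ring
          rw [e1, e2]
          linarith [hcombr, hπ3, hπ5, hπ7, hπ11, hP2, hP4, hP6, hP8]
        have hL2 : (0 : ℝ) < L ^ 2 := by positivity
        have hkey : Y * L ^ 2 ≤ (h : ℝ) * G * L ^ 2 := by
          have e3 : ((7.51352 * Y - 24.41894) / L - 2 - 239.26 * Y / L ^ 2) * L ^ 2
              = 7.51352 * Y * L - 24.41894 * L - 2 * L ^ 2 - 239.26 * Y := by
            field_simp
          have h1 : (7.51352 * Y * L - 24.41894 * L - 2 * L ^ 2 - 239.26 * Y) * h ≤ G * L ^ 2 * h := by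
            rw [← e3]
            exact mul_le_mul_of_nonneg_right (mul_le_mul_of_nonneg_right hG1 hL2.le) hh0.le
          have h2 : Y * (L ^ 2 + h) ≤ Y * (h * (7.51352 * L - 239.26)) :=
            mul_le_mul_of_nonneg_left hq (by linarith)
          have h3 : 24.41894 * L + 2 * L ^ 2 ≤ Y := by
            nlinarith [mul_nonneg (sub_nonneg.2 hL4) hLpos.le]
          have h3' : (h : ℝ) * (24.41894 * L + 2 * L ^ 2) ≤ h * Y := mul_le_mul_of_nonneg_left h3 hh0.le
          nlinarith [h1, h2, h3']
        have hfin := le_of_mul_le_mul_right hkey hL2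
        rw [div_le_iff₀ hh0, mul_comm]
        exact hfin
      · rcases le_or_gt L L₃ with hmid3 | hmid3
        · -- SEVEN SHIFTS on `(e^{L₂}, e^{L₃}]`
          have hq := hquad7 L hmid2.le hmid3
          have he118 : Real.exp 118 ≤ ((2 * y : ℕ) : ℝ) := by
            have : Real.exp 118 ≤ Real.exp L := Real.exp_le_exp.mpr (hL₂.trans hmid2.le)
            rwa [hLdef, Real.exp_log h2y0] at this
          have hP7 : ∀ d : ℕ, d ≠ 0 → Even d →
              (#((Nat.primesLE (2 * y)).filter (fun p => (p + d).Prime)) : ℝ)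
                ≤ 13.23 * oddSingularFactor d * ((2 * y : ℕ) : ℝ) / L ^ 2 := by
            intro d hd hde
            rw [hLdef]
            exact pairCount_le_1323 (N := 2 * y) (h := d) he118 hd hde
          have hP2 := hP7 2 (by norm_num) (by norm_num)
          have hP4 := hP7 4 (by norm_num) (by norm_num)
          have hP6 := hP7 6 (by norm_num) (by norm_num)
          have hP8 := hP7 8 (by norm_num) (by norm_num)
          have hP10 := hP7 10 (by norm_num) (by norm_num)
          have hP12 := hP7 12 (by norm_num) (by norm_num)
          have hP14 := hP7 14 (by norm_num) (by norm_num)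
          have hP16 := hP7 16 (by norm_num) (by norm_num)
          rw [oddSingularFactor_two'] at hP2
          rw [oddSingularFactor_four] at hP4
          rw [oddSingularFactor_six] at hP6
          rw [oddSingularFactor_eight] at hP8
          rw [oddSingularFactor_ten] at hP10
          rw [oddSingularFactor_twelve] at hP12
          rw [oddSingularFactor_fourteen] at hP14
          rw [oddSingularFactor_sixteen] at hP16
          have hcomb := seven_shift_count (y := y) (by omega)
          have hcombr : (Nat.primeCounting (2 * y - 3) : ℝ) + Nat.primeCounting (2 * y - 5)
              + Nat.primeCounting (2 * y - 7) + Nat.primeCounting (2 * y - 11) + Nat.primeCounting (2 * y - 13)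
              + Nat.primeCounting (2 * y - 17) + Nat.primeCounting (2 * y - 19)
              ≤ (#{b ∈ Ioc 0 y | b ∈ B} : ℝ) + 5
                + (4 * #((Nat.primesLE (2 * y)).filter (fun p => (p + 2).Prime))
                  + 3 * #((Nat.primesLE (2 * y)).filter (fun p => (p + 4).Prime))
                  + 4 * #((Nat.primesLE (2 * y)).filter (fun p => (p + 6).Prime))
                  + 3 * #((Nat.primesLE (2 * y)).filter (fun p => (p + 8).Prime))
                  + 2 * #((Nat.primesLE (2 * y)).filter (fun p => (p + 10).Prime))
                  + 2 * #((Nat.primesLE (2 * y)).filter (fun p => (p + 12).Prime))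
                  + 2 * #((Nat.primesLE (2 * y)).filter (fun p => (p + 14).Prime))
                  + #((Nat.primesLE (2 * y)).filter (fun p => (p + 16).Prime))) := by
            exact_mod_cast hcomb
          have hπ3 := hπ 3 (by norm_num)
          have hπ5 := hπ 5 (by norm_num)
          have hπ7 := hπ 7 (by norm_num)
          have hπ11 := hπ 11 (by norm_num)
          have hπ13 := hπ 13 (by norm_num)
          have hπ17 := hπ 17 (by norm_num)
          have hπ19 := hπ 19 (by norm_num)
          push_cast at hπ3 hπ5 hπ7 hπ11 hπ13 hπ17 hπ19
          have h2yr : ((2 * y : ℕ) : ℝ) = 2 * (y : ℝ) := by push_cast; ring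
          rw [h2yr] at hP2 hP4 hP6 hP8 hP10 hP12 hP14 hP16
          set G : ℝ := (#{b ∈ Ioc 0 y | b ∈ B} : ℝ) with hG
          set Y : ℝ := (y : ℝ) with hY
          have hY0 : 0 ≤ Y := le_trans (by norm_num) hy58
          have hL2 : (0 : ℝ) < L ^ 2 := by positivity
          have hG1 : (13.14866 * Y - 70.43925) / L - 5 - 742.7 * Y / L ^ 2 ≤ G := by
            have e1 : (13.14866 * Y - 70.43925) / L
                = 0.93919 * (2 * Y - 3) / L + 0.93919 * (2 * Y - 5) / L + 0.93919 * (2 * Y - 7) / L + 0.93919 * (2 * Y - 11) / L + 0.93919 * (2 * Y - 13) / L + 0.93919 * (2 * Y - 17) / L + 0.93919 * (2 * Y - 19) / L := by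
              field_simp
              ring
            have e2 : 4 * (13.23 * 1 * (2 * Y) / L ^ 2) + 3 * (13.23 * 1 * (2 * Y) / L ^ 2)
                + 4 * (13.23 * 2 * (2 * Y) / L ^ 2) + 3 * (13.23 * 1 * (2 * Y) / L ^ 2)
                + 2 * (13.23 * (4 / 3) * (2 * Y) / L ^ 2) + 2 * (13.23 * 2 * (2 * Y) / L ^ 2)
                + 2 * (13.23 * (6 / 5) * (2 * Y) / L ^ 2) + 13.23 * 1 * (2 * Y) / L ^ 2
                = (185661 / 250) * Y / L ^ 2 := by
              field_simp
              ring
            have e3 : (185661 / 250 : ℝ) * Y / L ^ 2 ≤ 742.7 * Y / L ^ 2 :=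
              div_le_div_of_nonneg_right (mul_le_mul_of_nonneg_right (by norm_num) hY0) hL2.le
            rw [e1]
            linarith [hcombr, hπ3, hπ5, hπ7, hπ11, hπ13, hπ17, hπ19, hP2, hP4, hP6, hP8, hP10, hP12, hP14, hP16,
              e2, e3]
          have hkey : Y * L ^ 2 ≤ (h : ℝ) * G * L ^ 2 := by
            have e4 : ((13.14866 * Y - 70.43925) / L - 5 - 742.7 * Y / L ^ 2) * L ^ 2
                = 13.14866 * Y * L - 70.43925 * L - 5 * L ^ 2 - 742.7 * Y := by
              field_simp
            have h1 : (13.14866 * Y * L - 70.43925 * L - 5 * L ^ 2 - 742.7 * Y) * h ≤ G * L ^ 2 * h := by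
              rw [← e4]
              exact mul_le_mul_of_nonneg_right (mul_le_mul_of_nonneg_right hG1 hL2.le) hh0.le
            have h2 : Y * (L ^ 2 + h) ≤ Y * (h * (13.14866 * L - 742.7)) :=
              mul_le_mul_of_nonneg_left hq (by linarith)
            have h3 : 70.43925 * L + 5 * L ^ 2 ≤ Y := by
              nlinarith [mul_nonneg (sub_nonneg.2 hL4) hLpos.le]
            have h3' : (h : ℝ) * (70.43925 * L + 5 * L ^ 2) ≤ h * Y := mul_le_mul_of_nonneg_left h3 hh0.le
            nlinarith [h1, h2, h3']
          have hfin := le_of_mul_le_mul_right hkey hL2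
          rw [div_le_iff₀ hh0, mul_comm]
          exact hfin
        · -- TWELVE SHIFTS on `(e^{L₃}, e^{Λ₀})`, pair sieve at the threshold `e^207`
          have hq := hquad12 L hmid3.le hLΛ.le
          have he207 : Real.exp 207 ≤ ((2 * y : ℕ) : ℝ) := by
            have : Real.exp 207 ≤ Real.exp L := Real.exp_le_exp.mpr (hL₃.trans hmid3.le)
            rwa [hLdef, Real.exp_log h2y0] at this
          have hPt : ∀ d : ℕ, d ≠ 0 → Even d →
              (#((Nat.primesLE (2 * y)).filter (fun p => (p + d).Prime)) : ℝ)
                ≤ 12.46 * oddSingularFactor d * ((2 * y : ℕ) : ℝ) / L ^ 2 := by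
            intro d hd hde
            rw [hLdef]
            exact pairCount_le_1246 (N := 2 * y) (h := d) he207 hd hde
          have hQ2 := hPt 2 (by norm_num) (by norm_num)
          have hQ4 := hPt 4 (by norm_num) (by norm_num)
          have hQ6 := hPt 6 (by norm_num) (by norm_num)
          have hQ8 := hPt 8 (by norm_num) (by norm_num)
          have hQ10 := hPt 10 (by norm_num) (by norm_num)
          have hQ12 := hPt 12 (by norm_num) (by norm_num)
          have hQ14 := hPt 14 (by norm_num) (by norm_num)
          have hQ16 := hPt 16 (by norm_num) (by norm_num)
          have hQ18 := hPt 18 (by norm_num) (by norm_num)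
          have hQ20 := hPt 20 (by norm_num) (by norm_num)
          have hQ22 := hPt 22 (by norm_num) (by norm_num)
          have hQ24 := hPt 24 (by norm_num) (by norm_num)
          have hQ26 := hPt 26 (by norm_num) (by norm_num)
          have hQ28 := hPt 28 (by norm_num) (by norm_num)
          have hQ30 := hPt 30 (by norm_num) (by norm_num)
          have hQ32 := hPt 32 (by norm_num) (by norm_num)
          have hQ34 := hPt 34 (by norm_num) (by norm_num)
          have hQ36 := hPt 36 (by norm_num) (by norm_num)
          have hQ38 := hPt 38 (by norm_num) (by norm_num)
          rw [oddSingularFactor_two'] at hQ2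
          rw [oddSingularFactor_four] at hQ4
          rw [oddSingularFactor_six] at hQ6
          rw [oddSingularFactor_eight] at hQ8
          rw [oddSingularFactor_ten] at hQ10
          rw [oddSingularFactor_twelve] at hQ12
          rw [oddSingularFactor_fourteen] at hQ14
          rw [oddSingularFactor_sixteen] at hQ16
          rw [oddSingularFactor_eighteen] at hQ18
          rw [oddSingularFactor_twenty] at hQ20
          rw [oddSingularFactor_twentytwo] at hQ22
          rw [oddSingularFactor_twentyfour] at hQ24
          rw [oddSingularFactor_twentysix] at hQ26
          rw [oddSingularFactor_twentyeight] at hQ28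
          rw [oddSingularFactor_thirty] at hQ30
          rw [oddSingularFactor_thirtytwo] at hQ32
          rw [oddSingularFactor_thirtyfour] at hQ34
          rw [oddSingularFactor_thirtysix] at hQ36
          rw [oddSingularFactor_thirtyeight] at hQ38
          have hcomb := twelve_shift_count (y := y) (by omega)
          have hcombr : (Nat.primeCounting (2 * y - 3) : ℝ) + Nat.primeCounting (2 * y - 5)
              + Nat.primeCounting (2 * y - 7) + Nat.primeCounting (2 * y - 11) + Nat.primeCounting (2 * y - 13)
              + Nat.primeCounting (2 * y - 17) + Nat.primeCounting (2 * y - 19) + Nat.primeCounting (2 * y - 23)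
              + Nat.primeCounting (2 * y - 29) + Nat.primeCounting (2 * y - 31) + Nat.primeCounting (2 * y - 37)
              + Nat.primeCounting (2 * y - 41)
              ≤ (#{b ∈ Ioc 0 y | b ∈ (({0, 1} : Set ℕ) ∪ {m | ∃ p q : ℕ, p.Prime ∧ q.Prime ∧ p + q = 2 * m})} : ℝ) + 10
                + (5 * #((Nat.primesLE (2 * y)).filter (fun p => (p + 2).Prime))
                  + 5 * #((Nat.primesLE (2 * y)).filter (fun p => (p + 4).Prime))
                  + 7 * #((Nat.primesLE (2 * y)).filter (fun p => (p + 6).Prime))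
                  + 5 * #((Nat.primesLE (2 * y)).filter (fun p => (p + 8).Prime))
                  + 5 * #((Nat.primesLE (2 * y)).filter (fun p => (p + 10).Prime))
                  + 6 * #((Nat.primesLE (2 * y)).filter (fun p => (p + 12).Prime))
                  + 4 * #((Nat.primesLE (2 * y)).filter (fun p => (p + 14).Prime))
                  + 3 * #((Nat.primesLE (2 * y)).filter (fun p => (p + 16).Prime))
                  + 5 * #((Nat.primesLE (2 * y)).filter (fun p => (p + 18).Prime))
                  + 3 * #((Nat.primesLE (2 * y)).filter (fun p => (p + 20).Prime))
                  + 2 * #((Nat.primesLE (2 * y)).filter (fun p => (p + 22).Prime))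
                  + 4 * #((Nat.primesLE (2 * y)).filter (fun p => (p + 24).Prime))
                  + 3 * #((Nat.primesLE (2 * y)).filter (fun p => (p + 26).Prime))
                  + 2 * #((Nat.primesLE (2 * y)).filter (fun p => (p + 28).Prime))
                  + 2 * #((Nat.primesLE (2 * y)).filter (fun p => (p + 30).Prime))
                  + #((Nat.primesLE (2 * y)).filter (fun p => (p + 32).Prime))
                  + 2 * #((Nat.primesLE (2 * y)).filter (fun p => (p + 34).Prime))
                  + #((Nat.primesLE (2 * y)).filter (fun p => (p + 36).Prime))
                  + #((Nat.primesLE (2 * y)).filter (fun p => (p + 38).Prime))) := by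
            exact_mod_cast hcomb
          have hπ3 := hπ 3 (by norm_num)
          have hπ5 := hπ 5 (by norm_num)
          have hπ7 := hπ 7 (by norm_num)
          have hπ11 := hπ 11 (by norm_num)
          have hπ13 := hπ 13 (by norm_num)
          have hπ17 := hπ 17 (by norm_num)
          have hπ19 := hπ 19 (by norm_num)
          have hπ23 := hπ 23 (by norm_num)
          have hπ29 := hπ 29 (by norm_num)
          have hπ31 := hπ 31 (by norm_num)
          have hπ37 := hπ 37 (by norm_num)
          have hπ41 := hπ 41 (by norm_num)
          push_cast at hπ3 hπ5 hπ7 hπ11 hπ13 hπ17 hπ19 hπ23 hπ29 hπ31 hπ37 hπ41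
          have h2yr : ((2 * y : ℕ) : ℝ) = 2 * (y : ℝ) := by push_cast; ring
          rw [h2yr] at hQ2 hQ4 hQ6 hQ8 hQ10 hQ12 hQ14 hQ16 hQ18 hQ20 hQ22 hQ24 hQ26 hQ28 hQ30 hQ32 hQ34 hQ36 hQ38
          set G : ℝ := (#{b ∈ Ioc 0 y | b ∈ (({0, 1} : Set ℕ) ∪ {m | ∃ p q : ℕ, p.Prime ∧ q.Prime ∧ p + q = 2 * m})} : ℝ) with hG
          set Y : ℝ := (y : ℝ) with hY
          have hY0 : 0 ≤ Y := le_trans (by norm_num) hy58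
          have hL2 : (0 : ℝ) < L ^ 2 := by positivity
          have hG1 : (22.54056 * Y - 221.64884) / L - 10 - 2415 * Y / L ^ 2 ≤ G := by
            have e1 : (22.54056 * Y - 221.64884) / L
                = 0.93919 * (2 * Y - 3) / L + 0.93919 * (2 * Y - 5) / L + 0.93919 * (2 * Y - 7) / L + 0.93919 * (2 * Y - 11) / L
                  + 0.93919 * (2 * Y - 13) / L + 0.93919 * (2 * Y - 17) / L + 0.93919 * (2 * Y - 19) / L + 0.93919 * (2 * Y - 23) / L
                  + 0.93919 * (2 * Y - 29) / L + 0.93919 * (2 * Y - 31) / L + 0.93919 * (2 * Y - 37) / L + 0.93919 * (2 * Y - 41) / L := by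
              field_simp
              ring
            have e2 : 5 * (12.46 * 1 * (2 * Y) / L ^ 2)
                + 5 * (12.46 * 1 * (2 * Y) / L ^ 2)
                + 7 * (12.46 * 2 * (2 * Y) / L ^ 2)
                + 5 * (12.46 * 1 * (2 * Y) / L ^ 2)
                + 5 * (12.46 * (4 / 3) * (2 * Y) / L ^ 2)
                + 6 * (12.46 * 2 * (2 * Y) / L ^ 2)
                + 4 * (12.46 * (6 / 5) * (2 * Y) / L ^ 2)
                + 3 * (12.46 * 1 * (2 * Y) / L ^ 2)
                + 5 * (12.46 * 2 * (2 * Y) / L ^ 2)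
                + 3 * (12.46 * (4 / 3) * (2 * Y) / L ^ 2)
                + 2 * (12.46 * (10 / 9) * (2 * Y) / L ^ 2)
                + 4 * (12.46 * 2 * (2 * Y) / L ^ 2)
                + 3 * (12.46 * (12 / 11) * (2 * Y) / L ^ 2)
                + 2 * (12.46 * (6 / 5) * (2 * Y) / L ^ 2)
                + 2 * (12.46 * (8 / 3) * (2 * Y) / L ^ 2)
                + 12.46 * 1 * (2 * Y) / L ^ 2
                + 2 * (12.46 * (16 / 15) * (2 * Y) / L ^ 2)
                + 12.46 * 2 * (2 * Y) / L ^ 2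
                + 12.46 * (18 / 17) * (2 * Y) / L ^ 2
                = (101587003 / 42075) * Y / L ^ 2 := by
              field_simp
              ring
            have e3 : (101587003 / 42075 : ℝ) * Y / L ^ 2 ≤ 2415 * Y / L ^ 2 :=
              div_le_div_of_nonneg_right (mul_le_mul_of_nonneg_right (by norm_num) hY0) hL2.le
            rw [e1]
            linarith [hcombr, hπ3, hπ5, hπ7, hπ11, hπ13, hπ17, hπ19, hπ23, hπ29, hπ31, hπ37, hπ41,
              hQ2, hQ4, hQ6, hQ8, hQ10, hQ12, hQ14, hQ16, hQ18, hQ20, hQ22, hQ24, hQ26, hQ28, hQ30, hQ32, hQ34, hQ36, hQ38, e2, e3]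
          have hkey : Y * L ^ 2 ≤ (h : ℝ) * G * L ^ 2 := by
            have e4 : ((22.54056 * Y - 221.64884) / L - 10 - 2415 * Y / L ^ 2) * L ^ 2
                = 22.54056 * Y * L - 221.64884 * L - 10 * L ^ 2 - 2415 * Y := by
              field_simp
            have h1 : (22.54056 * Y * L - 221.64884 * L - 10 * L ^ 2 - 2415 * Y) * h ≤ G * L ^ 2 * h := by
              rw [← e4]
              exact mul_le_mul_of_nonneg_right (mul_le_mul_of_nonneg_right hG1 hL2.le) hh0.le
            have h2 : Y * (L ^ 2 + h) ≤ Y * (h * (22.54056 * L - 2415)) :=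
              mul_le_mul_of_nonneg_left hq (by linarith)
            have h3 : 221.64884 * L + 10 * L ^ 2 ≤ Y := by
              nlinarith [mul_nonneg (sub_nonneg.2 hL4) hLpos.le]
            have h3' : (h : ℝ) * (221.64884 * L + 10 * L ^ 2) ≤ h * Y := mul_le_mul_of_nonneg_left h3 hh0.le
            nlinarith [h1, h2, h3']
          have hfin := le_of_mul_le_mul_right hkey hL2
          rw [div_le_iff₀ hh0, mul_comm]
          exact hfin

/-! ### §24.5 Instances: the count at `(Λs, Λ₀, A) = (327, 339, 11.70)`, the unconditional glue with `h = 22`, density, Mann -/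

/-- **Unconditional, above `e^339`**: at least `x/44` EVEN Goldbach numbers in `(0, x]` (`J = 400` levels; `Λs = 327`,
`A = 11.70` from the `c = 16` sieve on the 68 cells, `c₁ = 0.441`; `(1/44)⁷·259.55·11.70⁸ = 0.2855 ≤ (0.4409·gHol4 339 − 0.0057)⁸ = 0.3012`).
[cite: Nathanson1996, Theorem 7.8 (proof, restricted to even N; explicit form proved here)] -/
theorem goldbach_even_count_ge_44_exp339 {x : ℕ} (hx : Real.exp 339 ≤ (x : ℝ)) :
    (x : ℝ) / 44 ≤ #{N ∈ Ioc 0 x | Even N ∧ ∃ p q : ℕ, p.Prime ∧ q.Prime ∧ p + q = N} := by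
  have h := goldbach_even_count_ge_holder400 (Λs := 327) (Λ₀ := 339) (A := 11.70) (c₁ := 0.441) (κ := 1 / 44)
    (by norm_num) (by norm_num) (by norm_num) (by norm_num) (by norm_num)
    (fun N hN hev => goldbachCount_le_1170 hN hev) (by norm_num) (by norm_num)
    (fun y hy => sum_goldbachCount_ge_0441 ((Real.exp_le_exp.mpr (by norm_num)).trans hy))
    (by unfold gHol4; norm_num) (by unfold gHol4; norm_num) hx
  have e : (1 : ℝ) / 44 * x = x / 44 := by ring
  rw [e] at h
  exact h

/-- **Unconditional count for all `y ≥ 1`**: `B(y) ≥ y/22` (one shift below `e^40.53 ≤ e^{1.8424·22}`, three shifts on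
`[40.53, 99]` (pair sieve `17.09` from `e^40`), four on `[99, 118]`, seven on `[118, 207]` (`13.23`), twelve on `[207, 339]`
(`12.46`), the count `x/44` above `e^339`; windows `[22.5, 101.5]`, `[43.4, 121.9]`, `[77.2, 212.1]`, `[156.8, 339.1]`). [cite: Nathanson1996, Theorem 7.8 (explicit constant for the halved set proved here)] -/
theorem half_count_ge_allN_22 {y : ℕ} (hy : 1 ≤ y) :
    (y : ℝ) / 22 ≤ #{b ∈ Ioc 0 y | b ∈ (({0, 1} : Set ℕ) ∪ {m | ∃ p q : ℕ, p.Prime ∧ q.Prime ∧ p + q = 2 * m})} := by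
  have h := half_count_ge_allN_three (L₁ := 40.53) (Lt := 99) (L₂ := 118) (L₃ := 207) (Λ₀ := 339) (h := 22)
    (by norm_num) (by norm_num) (by norm_num) (by norm_num) (by norm_num) (by norm_num)
    (fun L h1 h2 => by
      push_cast
      nlinarith [mul_nonneg (sub_nonneg.2 h1) (sub_nonneg.2 h2)])
    (fun L h1 h2 => by
      push_cast
      nlinarith [mul_nonneg (sub_nonneg.2 h1) (sub_nonneg.2 h2)])
    (fun L h1 h2 => by
      push_cast
      nlinarith [mul_nonneg (sub_nonneg.2 h1) (sub_nonneg.2 h2)])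
    (fun L h1 h2 => by
      push_cast
      nlinarith [mul_nonneg (sub_nonneg.2 h1) (sub_nonneg.2 h2)])
    (fun x hx => by
      have h1 := goldbach_even_count_ge_44_exp339 hx
      have e : (x : ℝ) / (2 * ((22 : ℕ) : ℝ)) = (x : ℝ) / 44 := by norm_num
      rw [e]
      exact h1) hy
  exact_mod_cast h

/-- **The halved density, `1/22`**: `σ({0, 1} ∪ {m : 2m = p + q}) ≥ 1/22`, unconditionally. [cite: Nathanson1996, Theorem 7.8 (explicit constant for the halved set proved here)] -/
theorem schnirelmannDensity_half_ge_22 :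
    (1 : ℝ) / 22 ≤ schnirelmannDensity
      (({0, 1} : Set ℕ) ∪ {m | ∃ p q : ℕ, p.Prime ∧ q.Prime ∧ p + q = 2 * m}) := by
  have h := schnirelmannDensity_ge_of_count' (K := 22)
    (S := ({0, 1} : Set ℕ) ∪ {m | ∃ p q : ℕ, p.Prime ∧ q.Prime ∧ p + q = 2 * m})
    (fun N hN => by have := half_count_ge_allN_22 hN; exact_mod_cast this)
  exact_mod_cast h

/-- ★★★★★★★★★★★★★★★★★ **UNCONDITIONAL: every integer `N ≥ 2` is a sum of at most `45` primes** (ROUND-40 «CELLS-2»: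
the count sieve on the `68` odd `19`-smooth squarefull cells `s ≤ 20000` (`TlowK3`, `97.0` percent of `1/C₂`; `A = 11.70`
at `e^327`, count `x/44` above `e^339`), the unconditional five-regime glue with the three shifts `{3,5,7}` from `e^40.53`
and Chebyshev's `(n+2)/20 ≤ π(n)` below `10⁶`, `h = 22`, Mann `2·22 + 1`).  ZERO named facts.
[cite: Nathanson1996, Thm 7.9 (Shnirel'man–Goldbach; explicit constant proved here)] -/
theorem schnirelmann_goldbach_le_45 (N : ℕ) (hN : 2 ≤ N) :
    ∃ M : Multiset ℕ, (∀ p ∈ M, p.Prime) ∧ Multiset.card M ≤ 45 ∧ M.sum = N := by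
  have hσ : (1 : ℝ) / ((22 : ℕ) : ℝ) ≤ schnirelmannDensity
      (({0, 1} : Set ℕ) ∪ {m | ∃ p q : ℕ, p.Prime ∧ q.Prime ∧ p + q = 2 * m}) := by
    have := schnirelmannDensity_half_ge_22
    exact_mod_cast this
  exact sum_of_primes_of_half_density_mann (h := 22) (by norm_num) hσ N hN

end Literature.NumberTheory.Sieve.ShnirelmanGoldbachExplicit
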